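import Literature.ModelTheory.ExponentialFields.SemialgebraicC1TriangulationLifting
import HarnessLib

/-!
# Panel beating, I: the squeeze of one simplex (Czapla–Pawłucki's `g`, `h`)

Topic `Literature/ModelTheory/ExponentialFields` — the first part of the "panel beating"
(tubular squeeze) engine of the `C¹`-triangulation theorem [OhmotoShiota2017, Thm. 3.1], in the
corrected form of [CzaplaPawlucki2018, §2 Part II]: around a simplex `τ` one composes the
triangulating map with the homeomorphism `h` that squeezes the transversal directions by the
factor `φ(|v| / (ε ω(u)))`, `ω` = product of the barycentric coordinates (so the tube pinches at
`∂τ`).  This file constructs `h` for one affinely independent vertex set and proves that it is a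
semialgebraic homeomorphism of `ℝⁿ`:

* `smoothstep` — the cubic `C¹` step `φ` (`= 0` on `(-∞,0]`, `= 1` on `[1,∞)`, `φ(0) = φ'(0) = 0`,
  `φ' > 0` on `(0,1)`): `hasDerivAt_smoothstep`, `contDiff_one_smoothstep`,
  `strictMonoOn_smoothstep`, `IsSemialgebraicFunOn.smoothstep_comp`;
* `psiFun` (`ψ(t) = φ(t) t`, the radial profile), `psiIso`, `psiInv` — strictly increasing
  homeomorphism of `ℝ` and its inverse, semialgebraic (`IsSemialgebraicFunOn.psiFun_comp`,
  `IsSemialgebraicFunOn.psiInv_comp`);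
* `weightMap`, `injective_weightMap` (affine independence), `dirSpan`, `SqueezeFrame` (vertex set,
  marked vertex, transversal complement `W`), `SqueezeFrame.isCompl_range`, and the frame maps
  `bary` (barycentric coordinates extended to `ℝⁿ`, constant along `W`, summing to `1`), `proj`
  (oblique projection onto the span), `perp` (`∈ W`), `omega` (`Π_v λ_v`), all smooth and
  semialgebraic;
* `rad` (Euclidean length of `perp`), `sparam` (`r / εω`), `sqz` / `unsqz` (the squeeze `g` and
  its inverse over the open simplex, `unsqz_sqz`, `sqz_unsqz`), `core` (`{all λ_v > 0}`),
  `squeeze` / `unsqueeze` (`g` on the core, identity elsewhere): `bary_squeeze`,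
  `norm_squeeze_sub_le` (`‖h x - x‖ ≤ ε |ω x|`), `continuous_squeeze`, `continuous_unsqueeze`,
  `squeezeHomeomorph`, `isSemialgebraicMapOn_squeeze`, and
  **`isSemialgHomeomorphOn_squeeze`** — `h_ε` is a semialgebraic homeomorphism of `ℝⁿ`.

Part II (to come): `h_ε` preserves the simplices of a complex in the star of `τ` for `ε` small,
is `C¹` over the core with `∂_v h → 0`, `∂_u h → (id, 0)` at `τ` ((2.8) of loc. cit.), and the
derivative estimates (2.9)–(2.11) for `f ∘ h`.

No named facts are introduced.

## References

* [CzaplaPawlucki2018] M. Czapla, W. Pawłucki, *Strict `C¹`-triangulations in o-minimal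
  structures*, Topol. Methods Nonlinear Anal. 52 (2018), 739–747, §2 Part II.
* [OhmotoShiota2017] T. Ohmoto, M. Shiota, *`C¹`-triangulations of semialgebraic sets*,
  J. Topology 10 (2017), 765–775, §3.
* [BochnakCosteRoy1998] J. Bochnak, M. Coste, M.-F. Roy, *Real Algebraic Geometry*, Springer 1998,
  §2.2.
-/

open Set Filter
open _root_.Topology

namespace Literature.ModelTheory.ExponentialFields

open Literature.NumberTheory.Transcendental (IsSemialgebraicFunOn IsSemialgebraicMapOn
  isSemialgebraicFunOn_iff)

section Smoothstep

/-- The clamp of `t` to `[0, 1]`. [folklore] -/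
noncomputable def stepClamp (t : ℝ) : ℝ := max 0 (min 1 t)

/-- **The cubic smoothstep** `φ(t) = 3s² - 2s³`, `s = clamp(t)`: Czapla–Pawłucki's step function
`φ` (any definable `C¹` function with `φ(0) = φ'(0) = 0`, `φ = 1` on `[1, ∞)`, `φ' > 0` on `(0, 1)`
will do; this one is semialgebraic). [cite: CzaplaPawlucki2018, §2 Part II] -/
noncomputable def smoothstep (t : ℝ) : ℝ := 3 * stepClamp t ^ 2 - 2 * stepClamp t ^ 3

/-- `stepClamp_of_nonpos`: elementary property of the profile functions. [folklore] -/
theorem stepClamp_of_nonpos {t : ℝ} (ht : t ≤ 0) : stepClamp t = 0 := by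
  unfold stepClamp
  rw [max_eq_left]
  exact (min_le_right _ _).trans ht

/-- `stepClamp_of_one_le`: elementary property of the profile functions. [folklore] -/
theorem stepClamp_of_one_le {t : ℝ} (ht : 1 ≤ t) : stepClamp t = 1 := by
  unfold stepClamp
  rw [min_eq_left ht, max_eq_right zero_le_one]

/-- `stepClamp_of_mem`: elementary property of the profile functions. [folklore] -/
theorem stepClamp_of_mem {t : ℝ} (ht : t ∈ Icc (0 : ℝ) 1) : stepClamp t = t := by
  unfold stepClamp
  rw [min_eq_right ht.2, max_eq_right ht.1]

/-- `stepClamp_mem`: elementary property of the profile functions. [folklore] -/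
theorem stepClamp_mem (t : ℝ) : stepClamp t ∈ Icc (0 : ℝ) 1 :=
  ⟨le_max_left _ _, max_le zero_le_one (min_le_left _ _)⟩

/-- `φ = 0` on `(-∞, 0]`. [cite: CzaplaPawlucki2018, §2 Part II] -/
theorem smoothstep_of_nonpos {t : ℝ} (ht : t ≤ 0) : smoothstep t = 0 := by
  simp [smoothstep, stepClamp_of_nonpos ht]

/-- `φ = 1` on `[1, ∞)`. [cite: CzaplaPawlucki2018, §2 Part II] -/
theorem smoothstep_of_one_le {t : ℝ} (ht : 1 ≤ t) : smoothstep t = 1 := by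
  simp [smoothstep, stepClamp_of_one_le ht]
  norm_num

/-- `φ(t) = 3t² - 2t³` on `[0, 1]`. [cite: CzaplaPawlucki2018, §2 Part II] -/
theorem smoothstep_of_mem {t : ℝ} (ht : t ∈ Icc (0 : ℝ) 1) : smoothstep t = 3 * t ^ 2 - 2 * t ^ 3 := by
  simp [smoothstep, stepClamp_of_mem ht]

/-- `0 ≤ φ ≤ 1`. [cite: CzaplaPawlucki2018, §2 Part II] -/
theorem smoothstep_mem_Icc (t : ℝ) : smoothstep t ∈ Icc (0 : ℝ) 1 := by
  obtain ⟨h0, h1⟩ := stepClamp_mem t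
  set s := stepClamp t
  have : smoothstep t = 3 * s ^ 2 - 2 * s ^ 3 := rfl
  rw [this]
  constructor <;> nlinarith [mul_nonneg h0 h0, mul_nonneg (mul_nonneg h0 h0) h0, mul_nonneg h0 (sub_nonneg.mpr h1)]

/-- The derivative formula: `φ'(t) = 6 s (1 - s)`, `s = clamp t` (so `φ'` vanishes outside
`(0, 1)`, in particular `φ'(0) = 0`). [cite: CzaplaPawlucki2018, §2 Part II] -/
theorem hasDerivAt_smoothstep (t : ℝ) :
    HasDerivAt smoothstep (6 * stepClamp t * (1 - stepClamp t)) t := by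
  -- the cubic and its derivative
  have hcubic : ∀ x : ℝ, HasDerivAt (fun x : ℝ => 3 * x ^ 2 - 2 * x ^ 3) (6 * x * (1 - x)) x := by
    intro x
    have h1 : HasDerivAt (fun x : ℝ => x ^ 2) (2 * x) x := by simpa using hasDerivAt_pow 2 x
    have h2 : HasDerivAt (fun x : ℝ => x ^ 3) (3 * x ^ 2) x := by simpa using hasDerivAt_pow 3 x
    have h := (h1.const_mul 3).sub (h2.const_mul 2)
    exact h.congr_deriv (by ring)
  rcases lt_trichotomy t 0 with ht | rfl | ht
  · -- locally zero
    have hev : smoothstep =ᶠ[𝓝 t] fun _ => 0 :=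
      (eventually_lt_nhds ht).mono fun x hx => smoothstep_of_nonpos hx.le
    rw [stepClamp_of_nonpos ht.le]
    simp only [mul_zero, zero_mul]
    exact (hasDerivAt_const t (0 : ℝ)).congr_of_eventuallyEq hev
  · -- at `0`: squeezed between `0` and `3x²`
    rw [stepClamp_of_nonpos le_rfl]
    simp only [mul_zero, zero_mul]
    rw [hasDerivAt_iff_isLittleO]
    simp only [smoothstep_of_nonpos le_rfl, sub_zero, smul_zero]
    refine Asymptotics.IsLittleO.of_bound fun c hc => ?_
    have hev : ∀ᶠ x in 𝓝 (0 : ℝ), |x| < min 1 (c / 3) :=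
      (continuous_abs.tendsto' 0 0 abs_zero).eventually (eventually_lt_nhds (by positivity))
    refine hev.mono fun x hx => ?_
    rw [lt_min_iff] at hx
    simp only [Real.norm_eq_abs]
    rcases le_or_gt x 0 with hx0 | hx0
    · rw [smoothstep_of_nonpos hx0, abs_zero]
      positivity
    · have hx1 : x ≤ 1 := by linarith [(abs_lt.mp hx.1).2]
      rw [smoothstep_of_mem ⟨hx0.le, hx1⟩, abs_of_pos hx0]
      rw [abs_of_nonneg (by nlinarith)]
      have : x < c / 3 := (abs_lt.mp hx.2).2
      nlinarith
  · rcases lt_trichotomy t 1 with ht1 | rfl | ht1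
    · -- on `(0, 1)`: the cubic
      have hev : smoothstep =ᶠ[𝓝 t] fun x => 3 * x ^ 2 - 2 * x ^ 3 :=
        ((eventually_gt_nhds ht).and (eventually_lt_nhds ht1)).mono fun x hx =>
          smoothstep_of_mem ⟨hx.1.le, hx.2.le⟩
      rw [stepClamp_of_mem ⟨ht.le, ht1.le⟩]
      exact (hcubic t).congr_of_eventuallyEq hev
    · -- at `1`: squeezed between `1 - 3(x-1)²` and `1`
      rw [stepClamp_of_one_le le_rfl]
      simp only [sub_self, mul_zero]
      rw [hasDerivAt_iff_isLittleO]
      simp only [smoothstep_of_one_le le_rfl, smul_zero, sub_zero]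
      refine Asymptotics.IsLittleO.of_bound fun c hc => ?_
      have hev : ∀ᶠ x in 𝓝 (1 : ℝ), |x - 1| < min 1 (c / 3) := by
        have : Tendsto (fun x : ℝ => |x - 1|) (𝓝 1) (𝓝 0) := by
          have h := ((continuous_id.sub continuous_const).abs : Continuous fun x : ℝ => |x - 1|)
          simpa using h.tendsto 1
        exact this.eventually (eventually_lt_nhds (by positivity))
      refine hev.mono fun x hx => ?_
      rw [lt_min_iff] at hx
      simp only [Real.norm_eq_abs]
      rcases le_or_gt 1 x with hx0 | hx0
      · rw [smoothstep_of_one_le hx0, sub_self, abs_zero]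
        positivity
      · have hx1 : 0 ≤ x := by linarith [(abs_lt.mp hx.1).1]
        rw [smoothstep_of_mem ⟨hx1, hx0.le⟩]
        have hx' : 1 - x < c / 3 := by linarith [(abs_lt.mp hx.2).1]
        have hid : 3 * x ^ 2 - 2 * x ^ 3 - 1 = -((1 - x) ^ 2 * (1 + 2 * x)) := by ring
        rw [hid, abs_neg, abs_of_nonneg (by positivity), abs_of_nonpos (by linarith)]
        have h1x : 0 < 1 - x := by linarith
        nlinarith [mul_pos h1x h1x, mul_pos (mul_pos h1x h1x) hc]
    · -- locally one
      have hev : smoothstep =ᶠ[𝓝 t] fun _ => 1 :=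
        (eventually_gt_nhds ht1).mono fun x hx => smoothstep_of_one_le hx.le
      rw [stepClamp_of_one_le ht1.le]
      simp only [sub_self, mul_zero]
      exact (hasDerivAt_const t (1 : ℝ)).congr_of_eventuallyEq hev

/-- `φ'` as a function. [cite: CzaplaPawlucki2018, §2 Part II] -/
theorem deriv_smoothstep (t : ℝ) : deriv smoothstep t = 6 * stepClamp t * (1 - stepClamp t) :=
  (hasDerivAt_smoothstep t).deriv

/-- The clamp is continuous. [folklore] -/
theorem continuous_stepClamp : Continuous stepClamp :=
  continuous_const.max (continuous_const.min continuous_id)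

/-- **`φ` is of class `C¹`.** [cite: CzaplaPawlucki2018, §2 Part II] -/
theorem contDiff_one_smoothstep : ContDiff ℝ 1 smoothstep := by
  rw [contDiff_one_iff_deriv]
  refine ⟨fun t => (hasDerivAt_smoothstep t).differentiableAt, ?_⟩
  have : deriv smoothstep = fun t => 6 * stepClamp t * (1 - stepClamp t) := funext deriv_smoothstep
  rw [this]
  exact (continuous_const.mul continuous_stepClamp).mul (continuous_const.sub continuous_stepClamp)

/-- `φ' > 0` on `(0, 1)`. [cite: CzaplaPawlucki2018, §2 Part II] -/
theorem deriv_smoothstep_pos {t : ℝ} (ht : t ∈ Ioo (0 : ℝ) 1) : 0 < deriv smoothstep t := by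
  rw [deriv_smoothstep, stepClamp_of_mem ⟨ht.1.le, ht.2.le⟩]
  have := ht.1
  have := ht.2
  positivity

/-- `φ` is strictly increasing on `[0, 1]`. [cite: CzaplaPawlucki2018, §2 Part II] -/
theorem strictMonoOn_smoothstep : StrictMonoOn smoothstep (Icc (0 : ℝ) 1) := by
  refine strictMonoOn_of_deriv_pos (convex_Icc 0 1) contDiff_one_smoothstep.continuous.continuousOn
    fun t ht => ?_
  rw [interior_Icc] at ht
  exact deriv_smoothstep_pos ht

/-- `φ` is continuous. [cite: CzaplaPawlucki2018, §2 Part II] -/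
theorem continuous_smoothstep : Continuous smoothstep := contDiff_one_smoothstep.continuous

/-- Composition with the clamp keeps real-semialgebraicity. [cite: BochnakCosteRoy1998, Prop. 2.2.6] -/
theorem IsSemialgebraicFunOn.stepClamp_comp {n : ℕ} {s : Set (Fin n → ℝ)} (hs : IsSemialgebraic ℝ s)
    {g : (Fin n → ℝ) → ℝ} (hg : IsSemialgebraicFunOn ℝ s g) :
    IsSemialgebraicFunOn ℝ s fun x => stepClamp (g x) := by
  unfold stepClamp
  have h1 : IsSemialgebraicFunOn ℝ s fun x => Min.min (1 : ℝ) (g x) :=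
    Literature.ModelTheory.ExponentialFields.IsSemialgebraicFunOn.min hs
      (by simpa using isSemialgebraicFunOn_algebraMap hs (1 : ℝ)) hg
  exact Literature.ModelTheory.ExponentialFields.IsSemialgebraicFunOn.max hs
    (by simpa using isSemialgebraicFunOn_algebraMap hs (0 : ℝ)) h1

/-- **`φ ∘ g` is semialgebraic for semialgebraic `g`** (in particular `φ` is a semialgebraic
function). [cite: BochnakCosteRoy1998, Prop. 2.2.6] -/
theorem IsSemialgebraicFunOn.smoothstep_comp {n : ℕ} {s : Set (Fin n → ℝ)} (hs : IsSemialgebraic ℝ s)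
    {g : (Fin n → ℝ) → ℝ} (hg : IsSemialgebraicFunOn ℝ s g) :
    IsSemialgebraicFunOn ℝ s fun x => smoothstep (g x) := by
  have hc := IsSemialgebraicFunOn.stepClamp_comp hs hg
  have h3 : IsSemialgebraicFunOn ℝ s fun _ => (3 : ℝ) := by
    simpa using isSemialgebraicFunOn_algebraMap hs (3 : ℝ)
  have h2 : IsSemialgebraicFunOn ℝ s fun _ => (2 : ℝ) := by
    simpa using isSemialgebraicFunOn_algebraMap hs (2 : ℝ)
  have hsq : IsSemialgebraicFunOn ℝ s ((fun x => stepClamp (g x)) * fun x => stepClamp (g x)) :=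
    IsSemialgebraicFunOn.mul_holds hc hc
  have hcube : IsSemialgebraicFunOn ℝ s (((fun x => stepClamp (g x)) * fun x => stepClamp (g x)) *
      fun x => stepClamp (g x)) := IsSemialgebraicFunOn.mul_holds hsq hc
  have h := IsSemialgebraicFunOn.sub_holds (IsSemialgebraicFunOn.mul_holds h3 hsq)
    (IsSemialgebraicFunOn.mul_holds h2 hcube)
  convert h using 1
  funext x
  simp only [smoothstep, Pi.sub_apply, Pi.mul_apply]
  ring

/-- The step function of one real variable, read on the line `Fin 1 → ℝ`, is semialgebraic.
[cite: BochnakCosteRoy1998, Prop. 2.2.6] -/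
theorem isSemialgebraicFunOn_smoothstep :
    IsSemialgebraicFunOn ℝ (univ : Set (Fin 1 → ℝ)) fun x => smoothstep (x 0) :=
  IsSemialgebraicFunOn.smoothstep_comp isSemialgebraic_univ (isSemialgebraicFunOn_apply isSemialgebraic_univ 0)

end Smoothstep

/-! ## The radial profile `ψ(t) = φ(t) t` and its inverse -/

section Psi

open Literature.NumberTheory.Transcendental.SemialgebraicMonotonicity

/-- **The radial profile** `ψ(t) = φ(t)·t` of the squeeze (`= t` for `t ≥ 1` and for `t ≤ 0`,
where the squeeze is not applied): the map `v ↦ φ(|v|) v` acts on rays by `|v| ↦ ψ(|v|)`.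
[cite: CzaplaPawlucki2018, §2 Part II] -/
noncomputable def psiFun (t : ℝ) : ℝ := if t ≤ 0 then t else smoothstep t * t

/-- `psiFun_of_nonpos`: elementary property of the profile functions. [folklore] -/
theorem psiFun_of_nonpos {t : ℝ} (ht : t ≤ 0) : psiFun t = t := by simp [psiFun, ht]

/-- `psiFun_of_pos`: elementary property of the profile functions. [folklore] -/
theorem psiFun_of_pos {t : ℝ} (ht : 0 < t) : psiFun t = smoothstep t * t := by
  simp [psiFun, not_le.mpr ht]

/-- `psiFun_of_nonneg`: elementary property of the profile functions. [folklore] -/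
theorem psiFun_of_nonneg {t : ℝ} (ht : 0 ≤ t) : psiFun t = smoothstep t * t := by
  rcases ht.eq_or_lt with rfl | ht
  · simp [psiFun]
  · exact psiFun_of_pos ht

/-- `psiFun_of_one_le`: elementary property of the profile functions. [folklore] -/
theorem psiFun_of_one_le {t : ℝ} (ht : 1 ≤ t) : psiFun t = t := by
  rw [psiFun_of_pos (by linarith), smoothstep_of_one_le ht, one_mul]

/-- `psiFun_zero`: elementary property of the profile functions. [folklore] -/
theorem psiFun_zero : psiFun 0 = 0 := psiFun_of_nonpos le_rfl

/-- `ψ` is strictly increasing. [cite: CzaplaPawlucki2018, §2 Part II] -/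
theorem strictMono_psiFun : StrictMono psiFun := by
  intro a b hab
  rcases le_or_gt b 0 with hb | hb
  · rw [psiFun_of_nonpos (hab.le.trans hb), psiFun_of_nonpos hb]
    exact hab
  rcases le_or_gt a 0 with ha | ha
  · rw [psiFun_of_nonpos ha, psiFun_of_pos hb]
    have h1 : 0 < smoothstep b := by
      rcases le_or_gt 1 b with hb1 | hb1
      · rw [smoothstep_of_one_le hb1]; exact one_pos
      · have := strictMonoOn_smoothstep ⟨le_rfl, zero_le_one⟩ ⟨hb.le, hb1.le⟩ hb
        rwa [smoothstep_of_nonpos le_rfl] at this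
    nlinarith
  rw [psiFun_of_pos ha, psiFun_of_pos hb]
  -- both positive
  have hφa := (smoothstep_mem_Icc a)
  have hφb := (smoothstep_mem_Icc b)
  have hmono : smoothstep a ≤ smoothstep b := by
    rcases le_or_gt 1 a with ha1 | ha1
    · rw [smoothstep_of_one_le ha1, smoothstep_of_one_le (ha1.trans hab.le)]
    rcases le_or_gt 1 b with hb1 | hb1
    · rw [smoothstep_of_one_le hb1]; exact hφa.2
    · exact (strictMonoOn_smoothstep ⟨ha.le, ha1.le⟩ ⟨hb.le, hb1.le⟩ hab).le
  have hφapos : 0 < smoothstep a := by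
    rcases le_or_gt 1 a with ha1 | ha1
    · rw [smoothstep_of_one_le ha1]; exact one_pos
    · have := strictMonoOn_smoothstep ⟨le_rfl, zero_le_one⟩ ⟨ha.le, ha1.le⟩ ha
      rwa [smoothstep_of_nonpos le_rfl] at this
  calc smoothstep a * a < smoothstep a * b := mul_lt_mul_of_pos_left hab hφapos
    _ ≤ smoothstep b * b := mul_le_mul_of_nonneg_right hmono hb.le

/-- `ψ` is continuous. [cite: CzaplaPawlucki2018, §2 Part II] -/
theorem continuous_psiFun : Continuous psiFun := by
  have h : psiFun = fun t => if t ≤ 0 then t else smoothstep t * t := rfl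
  rw [h]
  refine Continuous.if_le continuous_id (continuous_smoothstep.mul continuous_id) continuous_id
    continuous_const fun t ht => ?_
  rw [ht, smoothstep_of_nonpos le_rfl, zero_mul]

/-- `ψ` is surjective (it is the identity outside `(0, 1)`). [cite: CzaplaPawlucki2018, §2 Part II] -/
theorem surjective_psiFun : Function.Surjective psiFun := by
  intro y
  rcases le_or_gt y 0 with hy | hy
  · exact ⟨y, psiFun_of_nonpos hy⟩
  rcases le_or_gt 1 y with hy1 | hy1
  · exact ⟨y, psiFun_of_one_le hy1⟩
  · -- intermediate value on `[0, 1]`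
    have h0 : psiFun 0 ≤ y := by rw [psiFun_zero]; exact hy.le
    have h1 : y ≤ psiFun 1 := by rw [psiFun_of_one_le le_rfl]; exact hy1.le
    obtain ⟨t, -, ht⟩ := intermediate_value_Icc zero_le_one continuous_psiFun.continuousOn ⟨h0, h1⟩
    exact ⟨t, ht⟩

/-- `ψ` as an order isomorphism of `ℝ`. [cite: CzaplaPawlucki2018, §2 Part II] -/
noncomputable def psiIso : ℝ ≃o ℝ := strictMono_psiFun.orderIsoOfSurjective psiFun surjective_psiFun

/-- `psiIso_apply`: elementary property of the profile functions. [folklore] -/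
theorem psiIso_apply (t : ℝ) : psiIso t = psiFun t := rfl

/-- The inverse profile `ψ⁻¹`. [cite: CzaplaPawlucki2018, §2 Part II] -/
noncomputable def psiInv (y : ℝ) : ℝ := psiIso.symm y

/-- `psiInv_psiFun`: elementary property of the profile functions. [folklore] -/
theorem psiInv_psiFun (t : ℝ) : psiInv (psiFun t) = t :=
  strictMono_psiFun.orderIsoOfSurjective_symm_apply_self psiFun surjective_psiFun t

/-- `psiFun_psiInv`: elementary property of the profile functions. [folklore] -/
theorem psiFun_psiInv (y : ℝ) : psiFun (psiInv y) = y :=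
  strictMono_psiFun.orderIsoOfSurjective_self_symm_apply psiFun surjective_psiFun y

/-- `ψ⁻¹` is continuous. [cite: CzaplaPawlucki2018, §2 Part II] -/
theorem continuous_psiInv : Continuous psiInv := psiIso.symm.continuous

/-- `ψ⁻¹` is strictly increasing. [cite: CzaplaPawlucki2018, §2 Part II] -/
theorem strictMono_psiInv : StrictMono psiInv := psiIso.symm.strictMono

/-- `psiInv_of_nonpos`: elementary property of the profile functions. [folklore] -/
theorem psiInv_of_nonpos {y : ℝ} (hy : y ≤ 0) : psiInv y = y := by
  conv_lhs => rw [← psiFun_of_nonpos hy]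
  exact psiInv_psiFun y

/-- `psiInv_of_one_le`: elementary property of the profile functions. [folklore] -/
theorem psiInv_of_one_le {y : ℝ} (hy : 1 ≤ y) : psiInv y = y := by
  conv_lhs => rw [← psiFun_of_one_le hy]
  exact psiInv_psiFun y

/-- `psiInv_nonneg`: elementary property of the profile functions. [folklore] -/
theorem psiInv_nonneg {y : ℝ} (hy : 0 ≤ y) : 0 ≤ psiInv y := by
  have := strictMono_psiInv.monotone hy
  rwa [psiInv_of_nonpos le_rfl] at this

/-- `ψ(t) ≤ t` for `t ≥ 0` (the squeeze moves points towards the simplex).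
[cite: CzaplaPawlucki2018, §2 Part II] -/
theorem psiFun_le_self {t : ℝ} (ht : 0 ≤ t) : psiFun t ≤ t := by
  rw [psiFun_of_nonneg ht]
  have := (smoothstep_mem_Icc t).2
  nlinarith

/-- `ψ` composed with semialgebraic functions is semialgebraic. [cite: BochnakCosteRoy1998, Prop. 2.2.6] -/
theorem IsSemialgebraicFunOn.psiFun_comp {n : ℕ} {s : Set (Fin n → ℝ)} (hs : IsSemialgebraic ℝ s)
    {g : (Fin n → ℝ) → ℝ} (hg : IsSemialgebraicFunOn ℝ s g) :
    IsSemialgebraicFunOn ℝ s fun x => psiFun (g x) := by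
  have h1 : IsSemialgebraicFunOn ℝ s ((fun x => smoothstep (g x)) * g) :=
    IsSemialgebraicFunOn.mul_holds (IsSemialgebraicFunOn.smoothstep_comp hs hg) hg
  -- `ψ(g) = max(g·φ(g), ?)`: rather, `ψ(t) = φ(t) t` for `t ≥ 0` and `= t` for `t ≤ 0`, i.e.
  -- `ψ(t) = min (t, φ(t) t)`? no: use the relation description
  refine IsSemialgebraicFunOn.of_rel (N := 2) hs (f := ![g, (fun x => smoothstep (g x)) * g])
    (fun i => ?_) (R := fun a t => (a 0 ≤ 0 ∧ t = a 0) ∨ (0 < a 0 ∧ t = a 1)) ?_ (fun x _ t => ?_)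
  · fin_cases i
    · simpa using hg
    · simpa using h1
  · have h : IsSemialgebraic ℝ {q : Fin (2 + 1) → ℝ |
        (q 0 ≤ 0 ∧ q (Fin.last 2) = q 0) ∨ (0 < q 0 ∧ q (Fin.last 2) = q 1)} :=
      sa_or (sa_and (sa_le_const 0 0) (sa_eq _ 0)) (sa_and (sa_const_lt 0 0) (sa_eq _ 1))
    convert h using 1
    ext q
    simp [Fin.init]
  · simp only [Matrix.cons_val_zero, Matrix.cons_val_one, Pi.mul_apply]
    constructor
    · rintro (⟨hle, rfl⟩ | ⟨hlt, rfl⟩)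
      · exact (psiFun_of_nonpos hle).symm
      · exact (psiFun_of_pos hlt).symm
    · rintro rfl
      rcases le_or_gt (g x) 0 with hle | hlt
      · exact Or.inl ⟨hle, psiFun_of_nonpos hle⟩
      · exact Or.inr ⟨hlt, psiFun_of_pos hlt⟩

/-- `ψ⁻¹` composed with semialgebraic functions is semialgebraic (its graph is the transpose of
the graph of `ψ`). [cite: BochnakCosteRoy1998, Prop. 2.2.6] -/
theorem IsSemialgebraicFunOn.psiInv_comp {n : ℕ} {s : Set (Fin n → ℝ)} (hs : IsSemialgebraic ℝ s)
    {g : (Fin n → ℝ) → ℝ} (hg : IsSemialgebraicFunOn ℝ s g) :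
    IsSemialgebraicFunOn ℝ s fun x => psiInv (g x) := by
  -- `t = ψ⁻¹(a) ↔ ψ(t) = a`, and `ψ` is semialgebraic in `t`
  have hψ : IsSemialgebraicFunOn ℝ (univ : Set (Fin 2 → ℝ)) fun q => psiFun (q 1) :=
    IsSemialgebraicFunOn.psiFun_comp isSemialgebraic_univ (isSemialgebraicFunOn_apply isSemialgebraic_univ 1)
  refine IsSemialgebraicFunOn.of_rel (N := 1) hs (f := ![g]) (fun i => ?_)
    (R := fun a t => psiFun t = a 0) ?_ (fun x _ t => ?_)
  · fin_cases i
    simpa using hg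
  · -- `{q : Fin 2 → ℝ | ψ (q 1) = q 0}` is the zero set of a semialgebraic function
    have h := IsSemialgebraicFunOn.sub_holds hψ (isSemialgebraicFunOn_apply isSemialgebraic_univ 0)
    have hF : IsSemialgebraicMapOn ℝ (univ : Set (Fin 2 → ℝ))
        (fun q => fun _ : Fin 1 => psiFun (q 1) - q 0) :=
      (Literature.NumberTheory.Transcendental.isSemialgebraicMapOn_iff_forall_holds
        isSemialgebraic_univ).mpr fun _ => h
    have hz := IsSemialgebraicMapOn.isSemialgebraic_sep_mem hF (sa_eq_const (n := 1) 0 0)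
    convert hz using 1
    ext q
    simp only [mem_setOf_eq, mem_univ, true_and, Fin.init]
    have h1 : q (Fin.last 1) = q 1 := rfl
    have h2 : q (Fin.castSucc 0) = q 0 := rfl
    rw [h1, h2]
    constructor
    · intro h
      linarith
    · intro h
      linarith
  · simp only [Matrix.cons_val_zero]
    constructor
    · intro h
      rw [← h, psiInv_psiFun]
    · rintro rfl
      exact psiFun_psiInv _

end Psi

/-! ## Affine frames adapted to a simplex: barycentric coordinates constant along a transversal
complement, the oblique projection onto the span, and the transversal component -/

section SimplexFrame

variable {n : ℕ}

/-- The weight map of a finite set of points `τ ⊂ ℝⁿ`: `w ↦ (Σ w_v v, Σ w_v)`; it is injective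
iff `τ` is affinely independent. [folklore] -/
noncomputable def weightMap (τ : Finset (Fin n → ℝ)) : (τ → ℝ) →ₗ[ℝ] (Fin n → ℝ) × ℝ :=
  (Fintype.linearCombination ℝ (fun v : τ => (v : Fin n → ℝ))).prod
    (Fintype.linearCombination ℝ (fun _ : τ => (1 : ℝ)))

/-- `weightMap_apply`: elementary property of the profile functions. [folklore] -/
theorem weightMap_apply (τ : Finset (Fin n → ℝ)) (w : τ → ℝ) :
    weightMap τ w = (∑ v, w v • (v : Fin n → ℝ), ∑ v, w v) := by
  simp [weightMap, Fintype.linearCombination_apply]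

/-- Affine independence makes the weight map injective. [folklore] -/
theorem injective_weightMap {τ : Finset (Fin n → ℝ)}
    (hτ : AffineIndependent ℝ ((↑) : τ → Fin n → ℝ)) : Function.Injective (weightMap τ) := by
  rw [← LinearMap.ker_eq_bot, LinearMap.ker_eq_bot']
  intro w hw
  rw [weightMap_apply, Prod.mk_eq_zero] at hw
  obtain ⟨h1, h2⟩ := hw
  funext v
  refine hτ Finset.univ w h2 ?_ v (Finset.mem_univ v)
  exact (Finset.weightedVSub_eq_linear_combination _ h2).trans h1

/-- The direction space of `τ` seen from the vertex `v₀`: the span of the `v - v₀`. [folklore] -/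
noncomputable def dirSpan (τ : Finset (Fin n → ℝ)) (v₀ : Fin n → ℝ) : Submodule ℝ (Fin n → ℝ) :=
  LinearMap.range (Fintype.linearCombination ℝ (fun v : τ => (v : Fin n → ℝ) - v₀))

/-- **A frame adapted to a simplex**: an affinely independent vertex set `τ` with a marked vertex
and a linear complement `W` of its direction space (the transversal directions of the squeeze;
[CzaplaPawlucki2018] use the orthogonal complement). [cite: CzaplaPawlucki2018, §2 Part II] -/
structure SqueezeFrame (n : ℕ) where
  /-- the vertices of the simplex -/
  τ : Finset (Fin n → ℝ)
  /-- a marked vertex -/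
  v₀ : Fin n → ℝ
  hv₀ : v₀ ∈ τ
  indep : AffineIndependent ℝ ((↑) : τ → Fin n → ℝ)
  /-- the transversal complement -/
  W : Submodule ℝ (Fin n → ℝ)
  compl : IsCompl (dirSpan τ v₀) W

namespace SqueezeFrame

variable (F : SqueezeFrame n)

/-- The indicator weight of the marked vertex. [folklore] -/
noncomputable def delta₀ : F.τ → ℝ := Pi.single (⟨F.v₀, F.hv₀⟩ : F.τ) 1

/-- `sum_delta₀`: elementary property of the squeeze frame / squeeze maps. [cite: CzaplaPawlucki2018, §2 Part II] -/
theorem sum_delta₀ : ∑ v, F.delta₀ v = 1 := by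
  simp [delta₀]

/-- `weightMap_delta₀`: elementary property of the profile functions. [folklore] -/
theorem weightMap_delta₀ : weightMap F.τ F.delta₀ = (F.v₀, 1) := by
  rw [weightMap_apply, sum_delta₀]
  congr 1
  simp [delta₀, Pi.single_apply]

/-- A weight vector with sum zero maps into the direction space. [folklore] -/
theorem fst_weightMap_mem_dirSpan {w : F.τ → ℝ} (hw : ∑ v, w v = 0) :
    (weightMap F.τ w).1 ∈ dirSpan F.τ F.v₀ := by
  rw [weightMap_apply]
  refine ⟨w, ?_⟩
  simp only [Fintype.linearCombination_apply, smul_sub, Finset.sum_sub_distrib, ← Finset.sum_smul,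
    hw, zero_smul, sub_zero]

/-- **The range of the weight map and `W × 0` are complementary in `ℝⁿ × ℝ`.** [folklore] -/
theorem isCompl_range : IsCompl (LinearMap.range (weightMap F.τ)) (F.W.prod ⊥) := by
  refine isCompl_iff.mpr ⟨?_, ?_⟩
  · rw [Submodule.disjoint_def]
    rintro ⟨y, s⟩ ⟨w, hw⟩ ⟨hyW, hs⟩
    replace hs : s = 0 := hs
    subst hs
    have hw2 : ∑ v, w v = 0 := by
      have := congrArg Prod.snd hw
      rw [weightMap_apply] at this
      exact this
    have hy : y ∈ dirSpan F.τ F.v₀ := by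
      have := F.fst_weightMap_mem_dirSpan hw2
      rw [hw] at this
      exact this
    have hy0 : y = 0 := by
      have := Submodule.disjoint_def.mp F.compl.disjoint y hy hyW
      exact this
    simp [hy0]
  · rw [codisjoint_iff, eq_top_iff]
    rintro ⟨x, s⟩ -
    have hmem : x - s • F.v₀ ∈ dirSpan F.τ F.v₀ ⊔ F.W := by
      rw [F.compl.sup_eq_top]
      trivial
    obtain ⟨d, hd, w', hw', hsum⟩ := Submodule.mem_sup.mp hmem
    obtain ⟨c, rfl⟩ := hd
    -- the weights `c - (Σ c) δ₀ + s δ₀`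
    set wt : F.τ → ℝ := c + (s - ∑ v, c v) • F.delta₀ with hwt
    have hA1 : (weightMap F.τ wt).1 =
        (Fintype.linearCombination ℝ (fun v : F.τ => (v : Fin n → ℝ) - F.v₀) c) + s • F.v₀ := by
      rw [hwt, map_add, map_smul, weightMap_delta₀, Prod.fst_add, Prod.smul_fst, weightMap_apply,
        Fintype.linearCombination_apply]
      simp only [smul_sub, Finset.sum_sub_distrib, ← Finset.sum_smul]
      module
    have hA2 : (weightMap F.τ wt).2 = s := by
      rw [hwt, map_add, map_smul, weightMap_delta₀, Prod.snd_add, Prod.smul_snd, weightMap_apply]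
      simp only [smul_eq_mul, mul_one]
      ring
    refine Submodule.mem_sup.mpr ⟨weightMap F.τ wt, ⟨wt, rfl⟩, (w', 0), ⟨hw', by simp⟩, ?_⟩
    have hsum' : (Fintype.linearCombination ℝ fun v : F.τ => (v : Fin n → ℝ) - F.v₀) c + w' =
        x - s • F.v₀ := hsum
    refine Prod.ext ?_ ?_
    · rw [Prod.fst_add, hA1]
      show (Fintype.linearCombination ℝ fun v : F.τ => (v : Fin n → ℝ) - F.v₀) c + s • F.v₀ + w' = x
      rw [add_right_comm, hsum', sub_add_cancel]
    · rw [Prod.snd_add, hA2]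
      simp

/-- **The barycentric coordinate map** of the frame: `x ↦ Λ(x, 1)` where `Λ` is the left inverse
of the weight map vanishing on `W × 0`; affine in `x`, constant along `W`.
[cite: CzaplaPawlucki2018, §2 Part II] -/
noncomputable def lam : ((Fin n → ℝ) × ℝ) →ₗ[ℝ] (F.τ → ℝ) :=
  LinearMap.linearProjOfIsCompl (F.W.prod ⊥) (weightMap F.τ) (injective_weightMap F.indep) F.isCompl_range

/-- Barycentric coordinates of a point (extended to all of `ℝⁿ`). [cite: CzaplaPawlucki2018, §2 Part II] -/
noncomputable def bary (x : Fin n → ℝ) : F.τ → ℝ := F.lam (x, 1)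

/-- **Barycentric coordinates of affine combinations of the vertices.** [folklore] -/
theorem bary_eq_of_weights {w : F.τ → ℝ} (hw : ∑ v, w v = 1) :
    F.bary (∑ v, w v • (v : Fin n → ℝ)) = w := by
  have h : (∑ v, w v • (v : Fin n → ℝ), (1 : ℝ)) = weightMap F.τ w := by
    rw [weightMap_apply, hw]
  rw [bary, h]
  exact LinearMap.linearProjOfIsCompl_apply_left _ _ _ _ w

/-- **Barycentric coordinates are constant along the transversal complement.** [folklore] -/
theorem bary_add_of_mem_W (x : Fin n → ℝ) {w : Fin n → ℝ} (hw : w ∈ F.W) :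
    F.bary (x + w) = F.bary x := by
  have h : ((x + w, (1 : ℝ)) : (Fin n → ℝ) × ℝ) = (x, 1) + (w, 0) := by
    rw [Prod.mk_add_mk, add_zero]
  rw [bary, h, map_add, bary]
  have : F.lam (w, 0) = 0 :=
    LinearMap.linearProjOfIsCompl_apply_right' _ _ _ _ _ ⟨hw, by simp⟩
  rw [this, add_zero]

/-- The decomposition of `(x, 1)` along `range A ⊕ (W × 0)`. [folklore] -/
theorem exists_decomp (x : Fin n → ℝ) :
    ∃ (w : F.τ → ℝ) (w' : Fin n → ℝ), w' ∈ F.W ∧ ∑ v, w v = 1 ∧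
      x = ∑ v, w v • (v : Fin n → ℝ) + w' ∧ F.bary x = w := by
  have hmem : ((x, (1 : ℝ)) : (Fin n → ℝ) × ℝ) ∈ LinearMap.range (weightMap F.τ) ⊔ F.W.prod ⊥ := by
    rw [F.isCompl_range.sup_eq_top]
    trivial
  obtain ⟨a, ⟨w, rfl⟩, b, ⟨hbW, hb0⟩, hsum⟩ := Submodule.mem_sup.mp hmem
  replace hb0 : b.2 = 0 := hb0
  have hb : b = (b.1, 0) := Prod.ext rfl hb0
  rw [weightMap_apply, hb, Prod.mk_add_mk, add_zero, Prod.mk.injEq] at hsum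
  obtain ⟨hx, hs⟩ := hsum
  refine ⟨w, b.1, hbW, hs, hx.symm, ?_⟩
  rw [← hx, F.bary_add_of_mem_W _ hbW, F.bary_eq_of_weights hs]

/-- **The barycentric coordinates sum to one.** [folklore] -/
theorem sum_bary (x : Fin n → ℝ) : ∑ v, F.bary x v = 1 := by
  obtain ⟨w, w', -, hs, -, hb⟩ := F.exists_decomp x
  rw [hb, hs]

/-- **The oblique projection onto the affine span of the simplex.** [cite: CzaplaPawlucki2018, §2 Part II] -/
noncomputable def proj (x : Fin n → ℝ) : Fin n → ℝ := ∑ v, F.bary x v • (v : Fin n → ℝ)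

/-- **The transversal component** `x - proj x ∈ W`. [cite: CzaplaPawlucki2018, §2 Part II] -/
noncomputable def perp (x : Fin n → ℝ) : Fin n → ℝ := x - F.proj x

/-- `proj_add_perp`: elementary property of the squeeze frame / squeeze maps. [cite: CzaplaPawlucki2018, §2 Part II] -/
theorem proj_add_perp (x : Fin n → ℝ) : F.proj x + F.perp x = x := by
  rw [perp, add_sub_cancel]

/-- `perp_mem_W`: elementary property of the squeeze frame / squeeze maps. [cite: CzaplaPawlucki2018, §2 Part II] -/
theorem perp_mem_W (x : Fin n → ℝ) : F.perp x ∈ F.W := by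
  obtain ⟨w, w', hw', -, hx, hb⟩ := F.exists_decomp x
  have : F.perp x = w' := by
    rw [perp, proj, hb]
    conv_lhs => rw [hx]
    abel
  rw [this]
  exact hw'

/-- The projection fixes affine combinations of the vertices. [folklore] -/
theorem proj_eq_of_weights {w : F.τ → ℝ} (hw : ∑ v, w v = 1) :
    F.proj (∑ v, w v • (v : Fin n → ℝ)) = ∑ v, w v • (v : Fin n → ℝ) := by
  rw [proj, F.bary_eq_of_weights hw]

/-- `bary_proj`: elementary property of the squeeze frame / squeeze maps. [cite: CzaplaPawlucki2018, §2 Part II] -/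
theorem bary_proj (x : Fin n → ℝ) : F.bary (F.proj x) = F.bary x := by
  rw [proj, F.bary_eq_of_weights (F.sum_bary x)]

/-- `proj_proj`: elementary property of the squeeze frame / squeeze maps. [cite: CzaplaPawlucki2018, §2 Part II] -/
theorem proj_proj (x : Fin n → ℝ) : F.proj (F.proj x) = F.proj x := by
  have h : F.proj (F.proj x) = ∑ v, F.bary (F.proj x) v • (v : Fin n → ℝ) := rfl
  rw [h, F.bary_proj]
  rfl

/-- `proj_add_of_mem_W`: elementary property of the squeeze frame / squeeze maps. [cite: CzaplaPawlucki2018, §2 Part II] -/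
theorem proj_add_of_mem_W (x : Fin n → ℝ) {w : Fin n → ℝ} (hw : w ∈ F.W) :
    F.proj (x + w) = F.proj x := by
  rw [proj, F.bary_add_of_mem_W x hw, proj]

/-- `perp_add_of_mem_W`: elementary property of the squeeze frame / squeeze maps. [cite: CzaplaPawlucki2018, §2 Part II] -/
theorem perp_add_of_mem_W (x : Fin n → ℝ) {w : Fin n → ℝ} (hw : w ∈ F.W) :
    F.perp (x + w) = F.perp x + w := by
  rw [perp, F.proj_add_of_mem_W x hw, perp]
  abel

/-- **The product of the barycentric coordinates** `ω = Π_v λ_v` (positive exactly over the open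
simplex, vanishing to first order on its boundary). [cite: CzaplaPawlucki2018, §2 Part II] -/
noncomputable def omega (x : Fin n → ℝ) : ℝ := ∏ v, F.bary x v

/-- `omega_add_of_mem_W`: elementary property of the squeeze frame / squeeze maps. [cite: CzaplaPawlucki2018, §2 Part II] -/
theorem omega_add_of_mem_W (x : Fin n → ℝ) {w : Fin n → ℝ} (hw : w ∈ F.W) :
    F.omega (x + w) = F.omega x := by
  rw [omega, F.bary_add_of_mem_W x hw, omega]

/-- `omega_pos`: elementary property of the squeeze frame / squeeze maps. [cite: CzaplaPawlucki2018, §2 Part II] -/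
theorem omega_pos {x : Fin n → ℝ} (h : ∀ v, 0 < F.bary x v) : 0 < F.omega x :=
  Finset.prod_pos fun v _ => h v

/-! ### Smoothness of the frame maps -/

/-- The barycentric map is affine, hence smooth. [folklore] -/
theorem contDiff_bary : ContDiff ℝ ⊤ F.bary := by
  have h1 : ContDiff ℝ ⊤ fun x : Fin n → ℝ => ((x, (1 : ℝ)) : (Fin n → ℝ) × ℝ) :=
    contDiff_id.prodMk contDiff_const
  have h2 : ContDiff ℝ ⊤ (F.lam : ((Fin n → ℝ) × ℝ) → (F.τ → ℝ)) := by
    simpa using (LinearMap.toContinuousLinearMap F.lam).contDiff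
  exact h2.comp h1

/-- `contDiff_bary_apply`: elementary property of the squeeze frame / squeeze maps. [cite: CzaplaPawlucki2018, §2 Part II] -/
theorem contDiff_bary_apply (v : F.τ) : ContDiff ℝ ⊤ fun x => F.bary x v :=
  (contDiff_apply ℝ ℝ v).comp F.contDiff_bary

/-- `contDiff_proj`: elementary property of the squeeze frame / squeeze maps. [cite: CzaplaPawlucki2018, §2 Part II] -/
theorem contDiff_proj : ContDiff ℝ ⊤ F.proj := by
  unfold proj
  refine ContDiff.sum fun v _ => ?_
  exact (F.contDiff_bary_apply v).smul contDiff_const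

/-- `contDiff_perp`: elementary property of the squeeze frame / squeeze maps. [cite: CzaplaPawlucki2018, §2 Part II] -/
theorem contDiff_perp : ContDiff ℝ ⊤ F.perp :=
  contDiff_id.sub F.contDiff_proj

/-- `contDiff_omega`: elementary property of the squeeze frame / squeeze maps. [cite: CzaplaPawlucki2018, §2 Part II] -/
theorem contDiff_omega : ContDiff ℝ ⊤ F.omega := by
  unfold omega
  exact contDiff_prod fun v _ => F.contDiff_bary_apply v

/-- `continuous_bary`: elementary property of the squeeze frame / squeeze maps. [cite: CzaplaPawlucki2018, §2 Part II] -/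
theorem continuous_bary : Continuous F.bary := F.contDiff_bary.continuous
/-- `continuous_proj`: elementary property of the squeeze frame / squeeze maps. [cite: CzaplaPawlucki2018, §2 Part II] -/
theorem continuous_proj : Continuous F.proj := F.contDiff_proj.continuous
/-- `continuous_perp`: elementary property of the squeeze frame / squeeze maps. [cite: CzaplaPawlucki2018, §2 Part II] -/
theorem continuous_perp : Continuous F.perp := F.contDiff_perp.continuous
/-- `continuous_omega`: elementary property of the squeeze frame / squeeze maps. [cite: CzaplaPawlucki2018, §2 Part II] -/
theorem continuous_omega : Continuous F.omega := F.contDiff_omega.continuous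


/-! ### The transversal radius and the squeeze map -/

/-- **The transversal radius** `r(x) = ‖perp x‖₂` (Euclidean length of the transversal
component; smooth off the affine span). [cite: CzaplaPawlucki2018, §2 Part II] -/
noncomputable def rad (x : Fin n → ℝ) : ℝ := Real.sqrt (∑ i, F.perp x i ^ 2)

/-- `rad_nonneg`: elementary property of the squeeze frame / squeeze maps. [cite: CzaplaPawlucki2018, §2 Part II] -/
theorem rad_nonneg (x : Fin n → ℝ) : 0 ≤ F.rad x := Real.sqrt_nonneg _

/-- `rad_sq`: elementary property of the squeeze frame / squeeze maps. [cite: CzaplaPawlucki2018, §2 Part II] -/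
theorem rad_sq (x : Fin n → ℝ) : F.rad x ^ 2 = ∑ i, F.perp x i ^ 2 :=
  Real.sq_sqrt (Finset.sum_nonneg fun _ _ => sq_nonneg _)

/-- Coordinates of the transversal component are bounded by the radius. [folklore] -/
theorem abs_perp_le_rad (x : Fin n → ℝ) (i : Fin n) : |F.perp x i| ≤ F.rad x := by
  rw [← Real.sqrt_sq_eq_abs]
  exact Real.sqrt_le_sqrt (Finset.single_le_sum (fun j _ => sq_nonneg (F.perp x j)) (Finset.mem_univ i))

/-- `norm_perp_le_rad`: elementary property of the squeeze frame / squeeze maps. [cite: CzaplaPawlucki2018, §2 Part II] -/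
theorem norm_perp_le_rad (x : Fin n → ℝ) : ‖F.perp x‖ ≤ F.rad x := by
  refine (pi_norm_le_iff_of_nonneg (F.rad_nonneg x)).mpr fun i => ?_
  rw [Real.norm_eq_abs]
  exact F.abs_perp_le_rad x i

/-- `rad_eq_zero_iff`: elementary property of the squeeze frame / squeeze maps. [cite: CzaplaPawlucki2018, §2 Part II] -/
theorem rad_eq_zero_iff (x : Fin n → ℝ) : F.rad x = 0 ↔ F.perp x = 0 := by
  constructor
  · intro h
    funext i
    have := F.abs_perp_le_rad x i
    rw [h] at this
    exact abs_nonpos_iff.mp this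
  · intro h
    simp [rad, h]

/-- `rad_pos_iff`: elementary property of the squeeze frame / squeeze maps. [cite: CzaplaPawlucki2018, §2 Part II] -/
theorem rad_pos_iff (x : Fin n → ℝ) : 0 < F.rad x ↔ F.perp x ≠ 0 := by
  rw [← not_iff_not, not_lt, Ne, not_not, ← rad_eq_zero_iff]
  exact ⟨fun h => le_antisymm h (F.rad_nonneg x), fun h => h.le⟩

/-- Points of the form `proj x + t • perp x`: same projection, scaled transversal component.
[folklore] -/
theorem bary_proj_add_smul_perp (x : Fin n → ℝ) (t : ℝ) :
    F.bary (F.proj x + t • F.perp x) = F.bary x := by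
  rw [F.bary_add_of_mem_W _ (F.W.smul_mem t (F.perp_mem_W x)), F.bary_proj]

/-- `proj_proj_add_smul_perp`: elementary property of the squeeze frame / squeeze maps. [cite: CzaplaPawlucki2018, §2 Part II] -/
theorem proj_proj_add_smul_perp (x : Fin n → ℝ) (t : ℝ) :
    F.proj (F.proj x + t • F.perp x) = F.proj x := by
  rw [F.proj_add_of_mem_W _ (F.W.smul_mem t (F.perp_mem_W x)), F.proj_proj]

/-- `perp_proj_add_smul_perp`: elementary property of the squeeze frame / squeeze maps. [cite: CzaplaPawlucki2018, §2 Part II] -/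
theorem perp_proj_add_smul_perp (x : Fin n → ℝ) (t : ℝ) :
    F.perp (F.proj x + t • F.perp x) = t • F.perp x := by
  rw [perp, F.proj_proj_add_smul_perp]
  abel

/-- `omega_proj_add_smul_perp`: elementary property of the squeeze frame / squeeze maps. [cite: CzaplaPawlucki2018, §2 Part II] -/
theorem omega_proj_add_smul_perp (x : Fin n → ℝ) (t : ℝ) :
    F.omega (F.proj x + t • F.perp x) = F.omega x := by
  rw [omega, F.bary_proj_add_smul_perp, omega]

/-- `rad_proj_add_smul_perp`: elementary property of the squeeze frame / squeeze maps. [cite: CzaplaPawlucki2018, §2 Part II] -/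
theorem rad_proj_add_smul_perp (x : Fin n → ℝ) {t : ℝ} (ht : 0 ≤ t) :
    F.rad (F.proj x + t • F.perp x) = t * F.rad x := by
  rw [rad, F.perp_proj_add_smul_perp, rad]
  simp only [Pi.smul_apply, smul_eq_mul, mul_pow, ← Finset.mul_sum]
  rw [Real.sqrt_mul (sq_nonneg t), Real.sqrt_sq ht]

/-- **The squeeze parameter** `s(x) = r(x) / (ε ω(x))`. [cite: CzaplaPawlucki2018, §2 Part II] -/
noncomputable def sparam (ε : ℝ) (x : Fin n → ℝ) : ℝ := F.rad x / (ε * F.omega x)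

/-- **The squeeze** `g(x) = proj x + φ(s(x)) • perp x` (Czapla–Pawłucki's
`g(u, v) = (u, φ(|v| / εω(u)) v)`), used over the open simplex (`ω > 0`).
[cite: CzaplaPawlucki2018, §2 Part II] -/
noncomputable def sqz (ε : ℝ) (x : Fin n → ℝ) : Fin n → ℝ :=
  F.proj x + smoothstep (F.sparam ε x) • F.perp x

/-- **The inverse squeeze** `g⁻¹(x) = proj x + (εω ψ⁻¹(s)/r) • perp x` (`= x` on the span).
[cite: CzaplaPawlucki2018, §2 Part II] -/
noncomputable def unsqz (ε : ℝ) (x : Fin n → ℝ) : Fin n → ℝ :=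
  if F.rad x = 0 then x else
    F.proj x + (ε * F.omega x * psiInv (F.sparam ε x) / F.rad x) • F.perp x

/-- `sqz_eq_self_of_one_le`: elementary property of the squeeze frame / squeeze maps. [cite: CzaplaPawlucki2018, §2 Part II] -/
theorem sqz_eq_self_of_one_le {ε : ℝ} {x : Fin n → ℝ} (h : 1 ≤ F.sparam ε x) : F.sqz ε x = x := by
  rw [sqz, smoothstep_of_one_le h, one_smul, proj_add_perp]

/-- `proj_sqz`: elementary property of the squeeze frame / squeeze maps. [cite: CzaplaPawlucki2018, §2 Part II] -/
theorem proj_sqz (ε : ℝ) (x : Fin n → ℝ) : F.proj (F.sqz ε x) = F.proj x :=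
  F.proj_proj_add_smul_perp x _

/-- `perp_sqz`: elementary property of the squeeze frame / squeeze maps. [cite: CzaplaPawlucki2018, §2 Part II] -/
theorem perp_sqz (ε : ℝ) (x : Fin n → ℝ) : F.perp (F.sqz ε x) = smoothstep (F.sparam ε x) • F.perp x :=
  F.perp_proj_add_smul_perp x _

/-- `bary_sqz`: elementary property of the squeeze frame / squeeze maps. [cite: CzaplaPawlucki2018, §2 Part II] -/
theorem bary_sqz (ε : ℝ) (x : Fin n → ℝ) : F.bary (F.sqz ε x) = F.bary x :=
  F.bary_proj_add_smul_perp x _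

/-- `omega_sqz`: elementary property of the squeeze frame / squeeze maps. [cite: CzaplaPawlucki2018, §2 Part II] -/
theorem omega_sqz (ε : ℝ) (x : Fin n → ℝ) : F.omega (F.sqz ε x) = F.omega x :=
  F.omega_proj_add_smul_perp x _

/-- `rad_sqz`: elementary property of the squeeze frame / squeeze maps. [cite: CzaplaPawlucki2018, §2 Part II] -/
theorem rad_sqz (ε : ℝ) (x : Fin n → ℝ) : F.rad (F.sqz ε x) = smoothstep (F.sparam ε x) * F.rad x :=
  F.rad_proj_add_smul_perp x (smoothstep_mem_Icc _).1

/-- The squeeze moves points by at most the transversal radius: `‖g x - x‖ ≤ r(x)`.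
[cite: CzaplaPawlucki2018, §2 Part II] -/
theorem norm_sqz_sub_le (ε : ℝ) (x : Fin n → ℝ) : ‖F.sqz ε x - x‖ ≤ F.rad x := by
  have h : F.sqz ε x - x = (smoothstep (F.sparam ε x) - 1) • F.perp x := by
    have hx := F.proj_add_perp x
    calc F.sqz ε x - x = F.proj x + smoothstep (F.sparam ε x) • F.perp x - (F.proj x + F.perp x) := by
          rw [hx]; rfl
      _ = (smoothstep (F.sparam ε x) - 1) • F.perp x := by rw [sub_smul, one_smul]; abel
  rw [h, norm_smul]
  have h1 : ‖smoothstep (F.sparam ε x) - 1‖ ≤ 1 := by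
    obtain ⟨h0, h1⟩ := smoothstep_mem_Icc (F.sparam ε x)
    rw [Real.norm_eq_abs, abs_sub_comm, abs_of_nonneg (by linarith)]
    linarith
  calc ‖smoothstep (F.sparam ε x) - 1‖ * ‖F.perp x‖ ≤ 1 * ‖F.perp x‖ :=
      mul_le_mul_of_nonneg_right h1 (norm_nonneg _)
    _ ≤ F.rad x := by rw [one_mul]; exact F.norm_perp_le_rad x

/-- **The inverse squeeze inverts the squeeze** (over `ω > 0`, `ε > 0`).
[cite: CzaplaPawlucki2018, §2 Part II] -/
theorem unsqz_sqz {ε : ℝ} (hε : 0 < ε) {x : Fin n → ℝ} (hω : 0 < F.omega x) :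
    F.unsqz ε (F.sqz ε x) = x := by
  have hεω : 0 < ε * F.omega x := mul_pos hε hω
  rcases (F.rad_nonneg x).eq_or_lt with hr | hr
  · -- on the span nothing moves
    have hp : F.perp x = 0 := (F.rad_eq_zero_iff x).mp hr.symm
    have hs : F.sqz ε x = x := by
      rw [sqz, hp, smul_zero, add_zero]
      conv_rhs => rw [← F.proj_add_perp x, hp, add_zero]
    rw [hs, unsqz, if_pos hr.symm]
  · have hs_pos : 0 < F.sparam ε x := div_pos hr hεω
    have hφ_pos : 0 < smoothstep (F.sparam ε x) := by
      rcases le_or_gt 1 (F.sparam ε x) with h1 | h1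
      · rw [smoothstep_of_one_le h1]; exact one_pos
      · have := strictMonoOn_smoothstep ⟨le_rfl, zero_le_one⟩ ⟨hs_pos.le, h1.le⟩ hs_pos
        rwa [smoothstep_of_nonpos le_rfl] at this
    have hrad : F.rad (F.sqz ε x) = smoothstep (F.sparam ε x) * F.rad x := F.rad_sqz ε x
    have hrad_pos : 0 < F.rad (F.sqz ε x) := by rw [hrad]; exact mul_pos hφ_pos hr
    rw [unsqz, if_neg hrad_pos.ne', F.proj_sqz, F.omega_sqz, F.perp_sqz, smul_smul]
    have hsp : F.sparam ε (F.sqz ε x) = psiFun (F.sparam ε x) := by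
      rw [sparam, hrad, F.omega_sqz, psiFun_of_pos hs_pos, sparam]
      ring
    rw [hsp, psiInv_psiFun, hrad]
    have hcoef : ε * F.omega x * F.sparam ε x / (smoothstep (F.sparam ε x) * F.rad x) *
        smoothstep (F.sparam ε x) = 1 := by
      have hr' := hr.ne'
      have hφ' := hφ_pos.ne'
      have hε' := hε.ne'
      have hω' := hω.ne'
      have hnum : ε * F.omega x * F.sparam ε x = F.rad x := by
        rw [sparam]
        field_simp
      rw [hnum]
      field_simp
    rw [hcoef, one_smul, proj_add_perp]

/-- **The squeeze inverts the inverse squeeze** (over `ω > 0`, `ε > 0`).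
[cite: CzaplaPawlucki2018, §2 Part II] -/
theorem sqz_unsqz {ε : ℝ} (hε : 0 < ε) {x : Fin n → ℝ} (hω : 0 < F.omega x) :
    F.sqz ε (F.unsqz ε x) = x := by
  have hεω : 0 < ε * F.omega x := mul_pos hε hω
  rcases (F.rad_nonneg x).eq_or_lt with hr | hr
  · have hp : F.perp x = 0 := (F.rad_eq_zero_iff x).mp hr.symm
    rw [unsqz, if_pos hr.symm, sqz, hp, smul_zero, add_zero]
    conv_rhs => rw [← F.proj_add_perp x, hp, add_zero]
  · have hs_pos : 0 < F.sparam ε x := div_pos hr hεω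
    set c : ℝ := ε * F.omega x * psiInv (F.sparam ε x) / F.rad x with hc
    have hψpos : 0 < psiInv (F.sparam ε x) := by
      have := strictMono_psiInv hs_pos
      rwa [psiInv_of_nonpos le_rfl] at this
    have hc_pos : 0 < c := div_pos (mul_pos hεω hψpos) hr
    rw [unsqz, if_neg hr.ne']
    rw [sqz, F.proj_proj_add_smul_perp, F.perp_proj_add_smul_perp, smul_smul]
    have hsp : F.sparam ε (F.proj x + c • F.perp x) = psiInv (F.sparam ε x) := by
      rw [sparam, F.rad_proj_add_smul_perp x hc_pos.le, F.omega_proj_add_smul_perp, hc]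
      field_simp
    rw [hsp]
    have hφ : smoothstep (psiInv (F.sparam ε x)) * psiInv (F.sparam ε x) = F.sparam ε x := by
      rw [← psiFun_of_pos hψpos, psiFun_psiInv]
    have hcoef : smoothstep (psiInv (F.sparam ε x)) * c = 1 := by
      rw [hc]
      have : smoothstep (psiInv (F.sparam ε x)) * (ε * F.omega x * psiInv (F.sparam ε x) / F.rad x)
          = ε * F.omega x * (smoothstep (psiInv (F.sparam ε x)) * psiInv (F.sparam ε x)) / F.rad x := by
        ring
      rw [this, hφ, sparam]
      field_simp
    rw [hcoef, one_smul, proj_add_perp]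


/-! ### The global squeeze: `g` over the open simplex, the identity elsewhere -/

/-- **The core**: the cylinder over the open simplex, where all barycentric coordinates are
positive (`= τ × ℝ^{n-p}` in the coordinates of [CzaplaPawlucki2018]). [cite: CzaplaPawlucki2018, §2 Part II] -/
def core : Set (Fin n → ℝ) := {x | ∀ v, 0 < F.bary x v}

/-- `isOpen_core`: elementary property of the squeeze frame / squeeze maps. [cite: CzaplaPawlucki2018, §2 Part II] -/
theorem isOpen_core : IsOpen F.core := by
  have : F.core = ⋂ v : F.τ, {x | 0 < F.bary x v} := by
    ext x
    simp [core]
  rw [this]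
  exact isOpen_iInter_of_finite fun v => isOpen_lt continuous_const (F.contDiff_bary_apply v).continuous

/-- `omega_pos_of_mem_core`: elementary property of the squeeze frame / squeeze maps. [cite: CzaplaPawlucki2018, §2 Part II] -/
theorem omega_pos_of_mem_core {x : Fin n → ℝ} (hx : x ∈ F.core) : 0 < F.omega x := F.omega_pos hx

/-- `sqz_mem_core_iff`: elementary property of the squeeze frame / squeeze maps. [cite: CzaplaPawlucki2018, §2 Part II] -/
theorem sqz_mem_core_iff (ε : ℝ) (x : Fin n → ℝ) : F.sqz ε x ∈ F.core ↔ x ∈ F.core := by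
  simp only [core, mem_setOf_eq, F.bary_sqz]

/-- `bary_unsqz`: elementary property of the squeeze frame / squeeze maps. [cite: CzaplaPawlucki2018, §2 Part II] -/
theorem bary_unsqz (ε : ℝ) (x : Fin n → ℝ) : F.bary (F.unsqz ε x) = F.bary x := by
  unfold unsqz
  split_ifs
  · rfl
  · exact F.bary_proj_add_smul_perp x _

/-- `unsqz_mem_core_iff`: elementary property of the squeeze frame / squeeze maps. [cite: CzaplaPawlucki2018, §2 Part II] -/
theorem unsqz_mem_core_iff (ε : ℝ) (x : Fin n → ℝ) : F.unsqz ε x ∈ F.core ↔ x ∈ F.core := by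
  simp only [core, mem_setOf_eq, F.bary_unsqz]

open Classical in
/-- **The panel-beating homeomorphism of one simplex** `h_ε`: the squeeze `g` over the open
simplex, the identity elsewhere. [cite: CzaplaPawlucki2018, §2 Part II] -/
noncomputable def squeeze (ε : ℝ) (x : Fin n → ℝ) : Fin n → ℝ :=
  if x ∈ F.core then F.sqz ε x else x

open Classical in
/-- Its inverse. [cite: CzaplaPawlucki2018, §2 Part II] -/
noncomputable def unsqueeze (ε : ℝ) (x : Fin n → ℝ) : Fin n → ℝ :=
  if x ∈ F.core then F.unsqz ε x else x

/-- `squeeze_of_mem`: elementary property of the squeeze frame / squeeze maps. [cite: CzaplaPawlucki2018, §2 Part II] -/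
theorem squeeze_of_mem {ε : ℝ} {x : Fin n → ℝ} (hx : x ∈ F.core) : F.squeeze ε x = F.sqz ε x := by
  simp [squeeze, hx]

/-- `squeeze_of_not_mem`: elementary property of the squeeze frame / squeeze maps. [cite: CzaplaPawlucki2018, §2 Part II] -/
theorem squeeze_of_not_mem {ε : ℝ} {x : Fin n → ℝ} (hx : x ∉ F.core) : F.squeeze ε x = x := by
  simp [squeeze, hx]

/-- `unsqueeze_of_mem`: elementary property of the squeeze frame / squeeze maps. [cite: CzaplaPawlucki2018, §2 Part II] -/
theorem unsqueeze_of_mem {ε : ℝ} {x : Fin n → ℝ} (hx : x ∈ F.core) : F.unsqueeze ε x = F.unsqz ε x := by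
  simp [unsqueeze, hx]

/-- `unsqueeze_of_not_mem`: elementary property of the squeeze frame / squeeze maps. [cite: CzaplaPawlucki2018, §2 Part II] -/
theorem unsqueeze_of_not_mem {ε : ℝ} {x : Fin n → ℝ} (hx : x ∉ F.core) : F.unsqueeze ε x = x := by
  simp [unsqueeze, hx]

/-- `h⁻¹ ∘ h = id`. [cite: CzaplaPawlucki2018, §2 Part II] -/
theorem unsqueeze_squeeze {ε : ℝ} (hε : 0 < ε) (x : Fin n → ℝ) : F.unsqueeze ε (F.squeeze ε x) = x := by
  by_cases hx : x ∈ F.core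
  · rw [F.squeeze_of_mem hx, F.unsqueeze_of_mem ((F.sqz_mem_core_iff ε x).mpr hx),
      F.unsqz_sqz hε (F.omega_pos_of_mem_core hx)]
  · rw [F.squeeze_of_not_mem hx, F.unsqueeze_of_not_mem hx]

/-- `h ∘ h⁻¹ = id`. [cite: CzaplaPawlucki2018, §2 Part II] -/
theorem squeeze_unsqueeze {ε : ℝ} (hε : 0 < ε) (x : Fin n → ℝ) : F.squeeze ε (F.unsqueeze ε x) = x := by
  by_cases hx : x ∈ F.core
  · rw [F.unsqueeze_of_mem hx, F.squeeze_of_mem ((F.unsqz_mem_core_iff ε x).mpr hx),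
      F.sqz_unsqz hε (F.omega_pos_of_mem_core hx)]
  · rw [F.unsqueeze_of_not_mem hx, F.squeeze_of_not_mem hx]

/-- **The squeeze preserves the barycentric coordinates** (it moves points transversally).
[cite: CzaplaPawlucki2018, §2 Part II] -/
theorem bary_squeeze (ε : ℝ) (x : Fin n → ℝ) : F.bary (F.squeeze ε x) = F.bary x := by
  by_cases hx : x ∈ F.core
  · rw [F.squeeze_of_mem hx, F.bary_sqz]
  · rw [F.squeeze_of_not_mem hx]

/-- **Displacement bound**: `‖h_ε x - x‖ ≤ ε |ω(x)|` (the tube pinches at the boundary of the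
simplex). [cite: CzaplaPawlucki2018, §2 Part II, (2.7)] -/
theorem norm_squeeze_sub_le {ε : ℝ} (hε : 0 < ε) (x : Fin n → ℝ) :
    ‖F.squeeze ε x - x‖ ≤ ε * |F.omega x| := by
  by_cases hx : x ∈ F.core
  · rw [F.squeeze_of_mem hx]
    have hω := F.omega_pos_of_mem_core hx
    have hεω : 0 < ε * F.omega x := mul_pos hε hω
    rcases le_or_gt 1 (F.sparam ε x) with h1 | h1
    · rw [F.sqz_eq_self_of_one_le h1, sub_self, norm_zero]
      positivity
    · have hr : F.rad x ≤ ε * F.omega x := ((div_lt_one hεω).mp h1).le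
      calc ‖F.sqz ε x - x‖ ≤ F.rad x := F.norm_sqz_sub_le ε x
        _ ≤ ε * F.omega x := hr
        _ = ε * |F.omega x| := by rw [abs_of_pos hω]
  · rw [F.squeeze_of_not_mem hx, sub_self, norm_zero]
    positivity

/-! ### Continuity: `h_ε` and `h_ε⁻¹` are inverse homeomorphisms of `ℝⁿ` -/

/-- `continuous_rad`: elementary property of the squeeze frame / squeeze maps. [cite: CzaplaPawlucki2018, §2 Part II] -/
theorem continuous_rad : Continuous F.rad := by
  unfold rad
  exact Real.continuous_sqrt.comp (continuous_finsetSum _ fun i _ =>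
    ((continuous_apply i).comp F.continuous_perp).pow 2)

/-- `continuousOn_sparam`: elementary property of the squeeze frame / squeeze maps. [cite: CzaplaPawlucki2018, §2 Part II] -/
theorem continuousOn_sparam {ε : ℝ} (hε : ε ≠ 0) : ContinuousOn (F.sparam ε) F.core :=
  F.continuous_rad.continuousOn.div (continuous_const.mul F.continuous_omega).continuousOn
    fun _ hx => mul_ne_zero hε (F.omega_pos_of_mem_core hx).ne'

/-- `g` is continuous on the core (for `ε ≠ 0`). [cite: CzaplaPawlucki2018, §2 Part II] -/
theorem continuousOn_sqz {ε : ℝ} (hε : ε ≠ 0) : ContinuousOn (F.sqz ε) F.core := by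
  have hs : ContinuousOn (F.sparam ε) F.core :=
    F.continuous_rad.continuousOn.div (continuous_const.mul F.continuous_omega).continuousOn
      fun x hx => mul_ne_zero hε (F.omega_pos_of_mem_core hx).ne'
  exact F.continuous_proj.continuousOn.add
    ((continuous_smoothstep.comp_continuousOn hs).smul F.continuous_perp.continuousOn)

/-- **`h_ε` is continuous on `ℝⁿ`.** [cite: CzaplaPawlucki2018, §2 Part II] -/
theorem continuous_squeeze {ε : ℝ} (hε : 0 < ε) : Continuous (F.squeeze ε) := by
  rw [continuous_iff_continuousAt]
  intro x₀
  by_cases hx₀ : x₀ ∈ F.core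
  · -- locally the squeeze
    have hev : F.squeeze ε =ᶠ[𝓝 x₀] F.sqz ε :=
      Filter.eventuallyEq_of_mem (F.isOpen_core.mem_nhds hx₀) fun x hx => F.squeeze_of_mem hx
    rw [continuousAt_congr hev]
    exact (F.continuousOn_sqz hε.ne').continuousAt (F.isOpen_core.mem_nhds hx₀)
  · -- a nonpositive barycentric coordinate
    simp only [core, mem_setOf_eq, not_forall, not_lt] at hx₀
    obtain ⟨v, hv⟩ := hx₀
    rcases hv.lt_or_eq with hv | hv
    · -- locally the identity
      have hopen : IsOpen {x : Fin n → ℝ | F.bary x v < 0} :=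
        isOpen_lt (F.contDiff_bary_apply v).continuous continuous_const
      have hev : F.squeeze ε =ᶠ[𝓝 x₀] id :=
        Filter.eventuallyEq_of_mem (hopen.mem_nhds hv) fun x hx =>
          F.squeeze_of_not_mem fun h => (h v).le.not_gt hx
      rw [continuousAt_congr hev]
      exact continuousAt_id
    · -- on the boundary of the simplex: the displacement bound
      have hω₀ : F.omega x₀ = 0 := Finset.prod_eq_zero (Finset.mem_univ v) hv
      have hx₀' : x₀ ∉ F.core := fun h => (h v).ne' hv
      rw [ContinuousAt, F.squeeze_of_not_mem hx₀', tendsto_iff_norm_sub_tendsto_zero]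
      have hbound : ∀ x, ‖F.squeeze ε x - x₀‖ ≤ ε * |F.omega x| + ‖x - x₀‖ := fun x =>
        calc ‖F.squeeze ε x - x₀‖ = ‖(F.squeeze ε x - x) + (x - x₀)‖ := by rw [sub_add_sub_cancel]
          _ ≤ ‖F.squeeze ε x - x‖ + ‖x - x₀‖ := norm_add_le _ _
          _ ≤ ε * |F.omega x| + ‖x - x₀‖ := by gcongr; exact F.norm_squeeze_sub_le hε x
      have hlim : Tendsto (fun x => ε * |F.omega x| + ‖x - x₀‖) (𝓝 x₀) (𝓝 0) := by
        have h1 : Tendsto (fun x => ε * |F.omega x|) (𝓝 x₀) (𝓝 0) := by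
          have := (F.continuous_omega.abs.tendsto x₀).const_mul ε
          rwa [hω₀, abs_zero, mul_zero] at this
        have h2 : Tendsto (fun x : Fin n → ℝ => ‖x - x₀‖) (𝓝 x₀) (𝓝 0) := tendsto_norm_sub_self x₀
        simpa using h1.add h2
      exact squeeze_zero (fun x => norm_nonneg _) hbound hlim

/-- `ψ⁻¹(s) ≥ s` for `s ≥ 0`. [folklore] -/
theorem self_le_psiInv {y : ℝ} (hy : 0 ≤ y) : y ≤ psiInv y := by
  conv_lhs => rw [← psiFun_psiInv y]
  exact psiFun_le_self (psiInv_nonneg hy)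

/-- Displacement bound for the inverse squeeze on the core: `‖g⁻¹ x - x‖ ≤ ε ω(x) ψ⁻¹(s(x))`.
[cite: CzaplaPawlucki2018, §2 Part II] -/
theorem norm_unsqz_sub_le {ε : ℝ} (hε : 0 < ε) {x : Fin n → ℝ} (hx : x ∈ F.core) :
    ‖F.unsqz ε x - x‖ ≤ ε * F.omega x * psiInv (F.sparam ε x) := by
  have hω := F.omega_pos_of_mem_core hx
  have hεω : 0 < ε * F.omega x := mul_pos hε hω
  rcases (F.rad_nonneg x).eq_or_lt with hr | hr
  · rw [unsqz, if_pos hr.symm, sub_self, norm_zero]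
    exact mul_nonneg hεω.le (psiInv_nonneg (div_nonneg (F.rad_nonneg x) hεω.le))
  · have hs : 0 ≤ F.sparam ε x := div_nonneg (F.rad_nonneg x) hεω.le
    set c : ℝ := ε * F.omega x * psiInv (F.sparam ε x) / F.rad x with hc
    have hc1 : 1 ≤ c := by
      rw [hc, le_div_iff₀ hr, one_mul]
      have h := self_le_psiInv hs
      have h' : F.rad x / (ε * F.omega x) ≤ psiInv (F.sparam ε x) := h
      rw [div_le_iff₀ hεω] at h'
      linarith
    have hdiff : F.unsqz ε x - x = (c - 1) • F.perp x := by
      rw [unsqz, if_neg hr.ne']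
      have hx' := F.proj_add_perp x
      calc F.proj x + c • F.perp x - x = F.proj x + c • F.perp x - (F.proj x + F.perp x) := by rw [hx']
        _ = (c - 1) • F.perp x := by rw [sub_smul, one_smul]; abel
    rw [hdiff, norm_smul, Real.norm_eq_abs, abs_of_nonneg (by linarith)]
    calc (c - 1) * ‖F.perp x‖ ≤ (c - 1) * F.rad x :=
          mul_le_mul_of_nonneg_left (F.norm_perp_le_rad x) (by linarith)
      _ = ε * F.omega x * psiInv (F.sparam ε x) - F.rad x := by
          rw [hc]; field_simp
      _ ≤ ε * F.omega x * psiInv (F.sparam ε x) := by linarith [F.rad_nonneg x]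

/-- Global displacement bound for the inverse: `‖h⁻¹ x - x‖ ≤ ε |ω(x)|`.
[cite: CzaplaPawlucki2018, §2 Part II] -/
theorem norm_unsqueeze_sub_le {ε : ℝ} (hε : 0 < ε) (x : Fin n → ℝ) :
    ‖F.unsqueeze ε x - x‖ ≤ ε * |F.omega x| := by
  by_cases hx : x ∈ F.core
  · rw [F.unsqueeze_of_mem hx]
    have hω := F.omega_pos_of_mem_core hx
    have hεω : 0 < ε * F.omega x := mul_pos hε hω
    rcases le_or_gt 1 (F.sparam ε x) with h1 | h1
    · -- no displacement
      have hr : 0 < F.rad x := by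
        have : 0 < F.sparam ε x := one_pos.trans_le h1
        rw [sparam] at this
        exact (div_pos_iff_of_pos_right hεω).mp this
      have : F.unsqz ε x = x := by
        rw [unsqz, if_neg hr.ne', psiInv_of_one_le h1]
        have hcoef : ε * F.omega x * F.sparam ε x / F.rad x = 1 := by
          rw [sparam]; field_simp
        rw [hcoef, one_smul, proj_add_perp]
      rw [this, sub_self, norm_zero]
      positivity
    · calc ‖F.unsqz ε x - x‖ ≤ ε * F.omega x * psiInv (F.sparam ε x) := F.norm_unsqz_sub_le hε hx
        _ ≤ ε * F.omega x * 1 := by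
            gcongr
            rw [← psiInv_of_one_le le_rfl]
            exact strictMono_psiInv.monotone h1.le
        _ = ε * |F.omega x| := by rw [mul_one, abs_of_pos hω]
  · rw [F.unsqueeze_of_not_mem hx, sub_self, norm_zero]
    positivity

/-- `g⁻¹` is continuous on the core. [cite: CzaplaPawlucki2018, §2 Part II] -/
theorem continuousOn_unsqz {ε : ℝ} (hε : 0 < ε) : ContinuousOn (F.unsqz ε) F.core := by
  intro x₀ hx₀
  have hω₀ := F.omega_pos_of_mem_core hx₀
  have hs : ContinuousOn (F.sparam ε) F.core :=
    F.continuous_rad.continuousOn.div (continuous_const.mul F.continuous_omega).continuousOn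
      fun x hx => mul_ne_zero hε.ne' (F.omega_pos_of_mem_core hx).ne'
  rcases (F.rad_nonneg x₀).eq_or_lt with hr₀ | hr₀
  · -- on the span: displacement bound
    have hux₀ : F.unsqz ε x₀ = x₀ := by rw [unsqz, if_pos hr₀.symm]
    rw [ContinuousWithinAt, hux₀, tendsto_iff_norm_sub_tendsto_zero]
    have hbound : ∀ x ∈ F.core, ‖F.unsqz ε x - x₀‖ ≤ ε * F.omega x * psiInv (F.sparam ε x) + ‖x - x₀‖ :=
      fun x hx =>
      calc ‖F.unsqz ε x - x₀‖ = ‖(F.unsqz ε x - x) + (x - x₀)‖ := by rw [sub_add_sub_cancel]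
        _ ≤ ‖F.unsqz ε x - x‖ + ‖x - x₀‖ := norm_add_le _ _
        _ ≤ _ := by gcongr; exact F.norm_unsqz_sub_le hε hx
    have hs₀ : F.sparam ε x₀ = 0 := by rw [sparam, ← hr₀, zero_div]
    have hlim : Tendsto (fun x => ε * F.omega x * psiInv (F.sparam ε x) + ‖x - x₀‖) (𝓝[F.core] x₀) (𝓝 0) := by
      have h1 : Tendsto (fun x => ε * F.omega x * psiInv (F.sparam ε x)) (𝓝[F.core] x₀) (𝓝 0) := by
        have hc : ContinuousWithinAt (fun x => ε * F.omega x * psiInv (F.sparam ε x)) F.core x₀ :=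
          ((continuous_const.mul F.continuous_omega).continuousWithinAt).mul
            (continuous_psiInv.continuousAt.comp_continuousWithinAt (hs x₀ hx₀))
        have := hc.tendsto
        rwa [hs₀, psiInv_of_nonpos le_rfl, mul_zero] at this
      have h2 : Tendsto (fun x : Fin n → ℝ => ‖x - x₀‖) (𝓝[F.core] x₀) (𝓝 0) :=
        (tendsto_norm_sub_self x₀).mono_left nhdsWithin_le_nhds
      simpa using h1.add h2
    refine squeeze_zero' (Eventually.of_forall fun x => norm_nonneg _) ?_ hlim
    exact eventually_nhdsWithin_of_forall hbound
  · -- off the span: the formula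
    have hopen : IsOpen {x : Fin n → ℝ | 0 < F.rad x} := isOpen_lt continuous_const F.continuous_rad
    have hev : F.unsqz ε =ᶠ[𝓝[F.core] x₀]
        fun x => F.proj x + (ε * F.omega x * psiInv (F.sparam ε x) / F.rad x) • F.perp x := by
      refine Filter.eventuallyEq_of_mem (mem_nhdsWithin_of_mem_nhds (hopen.mem_nhds hr₀)) fun x hx => ?_
      have hx' : 0 < F.rad x := hx
      show F.unsqz ε x = _
      rw [unsqz, if_neg hx'.ne']
    have hcoef : ContinuousWithinAt (fun x => ε * F.omega x * psiInv (F.sparam ε x) / F.rad x) F.core x₀ := by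
      refine ContinuousWithinAt.div ?_ F.continuous_rad.continuousWithinAt hr₀.ne'
      exact ((continuous_const.mul F.continuous_omega).continuousWithinAt).mul
        (continuous_psiInv.continuousAt.comp_continuousWithinAt (hs x₀ hx₀))
    have hform : ContinuousWithinAt
        (fun x => F.proj x + (ε * F.omega x * psiInv (F.sparam ε x) / F.rad x) • F.perp x) F.core x₀ :=
      F.continuous_proj.continuousWithinAt.add (hcoef.smul F.continuous_perp.continuousWithinAt)
    refine hform.congr_of_eventuallyEq hev ?_
    rw [unsqz, if_neg hr₀.ne']

/-- **`h_ε⁻¹` is continuous on `ℝⁿ`.** [cite: CzaplaPawlucki2018, §2 Part II] -/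
theorem continuous_unsqueeze {ε : ℝ} (hε : 0 < ε) : Continuous (F.unsqueeze ε) := by
  rw [continuous_iff_continuousAt]
  intro x₀
  by_cases hx₀ : x₀ ∈ F.core
  · have hev : F.unsqueeze ε =ᶠ[𝓝 x₀] F.unsqz ε :=
      Filter.eventuallyEq_of_mem (F.isOpen_core.mem_nhds hx₀) fun x hx => F.unsqueeze_of_mem hx
    rw [continuousAt_congr hev]
    exact (F.continuousOn_unsqz hε).continuousAt (F.isOpen_core.mem_nhds hx₀)
  · simp only [core, mem_setOf_eq, not_forall, not_lt] at hx₀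
    obtain ⟨v, hv⟩ := hx₀
    rcases hv.lt_or_eq with hv | hv
    · have hopen : IsOpen {x : Fin n → ℝ | F.bary x v < 0} :=
        isOpen_lt (F.contDiff_bary_apply v).continuous continuous_const
      have hev : F.unsqueeze ε =ᶠ[𝓝 x₀] id :=
        Filter.eventuallyEq_of_mem (hopen.mem_nhds hv) fun x hx =>
          F.unsqueeze_of_not_mem fun h => (h v).le.not_gt hx
      rw [continuousAt_congr hev]
      exact continuousAt_id
    · have hω₀ : F.omega x₀ = 0 := Finset.prod_eq_zero (Finset.mem_univ v) hv
      have hx₀' : x₀ ∉ F.core := fun h => (h v).ne' hv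
      rw [ContinuousAt, F.unsqueeze_of_not_mem hx₀', tendsto_iff_norm_sub_tendsto_zero]
      have hbound : ∀ x, ‖F.unsqueeze ε x - x₀‖ ≤ ε * |F.omega x| + ‖x - x₀‖ := fun x =>
        calc ‖F.unsqueeze ε x - x₀‖ = ‖(F.unsqueeze ε x - x) + (x - x₀)‖ := by rw [sub_add_sub_cancel]
          _ ≤ ‖F.unsqueeze ε x - x‖ + ‖x - x₀‖ := norm_add_le _ _
          _ ≤ ε * |F.omega x| + ‖x - x₀‖ := by gcongr; exact F.norm_unsqueeze_sub_le hε x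
      have hlim : Tendsto (fun x => ε * |F.omega x| + ‖x - x₀‖) (𝓝 x₀) (𝓝 0) := by
        have h1 : Tendsto (fun x => ε * |F.omega x|) (𝓝 x₀) (𝓝 0) := by
          have := (F.continuous_omega.abs.tendsto x₀).const_mul ε
          rwa [hω₀, abs_zero, mul_zero] at this
        have h2 : Tendsto (fun x : Fin n → ℝ => ‖x - x₀‖) (𝓝 x₀) (𝓝 0) := tendsto_norm_sub_self x₀
        simpa using h1.add h2
      exact squeeze_zero (fun x => norm_nonneg _) hbound hlim

/-- **The panel beating of one simplex is a homeomorphism of `ℝⁿ`.** [cite: CzaplaPawlucki2018, §2 Part II] -/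
noncomputable def squeezeHomeomorph {ε : ℝ} (hε : 0 < ε) : (Fin n → ℝ) ≃ₜ (Fin n → ℝ) where
  toFun := F.squeeze ε
  invFun := F.unsqueeze ε
  left_inv := F.unsqueeze_squeeze hε
  right_inv := F.squeeze_unsqueeze hε
  continuous_toFun := F.continuous_squeeze hε
  continuous_invFun := F.continuous_unsqueeze hε


/-! ### Semialgebraicity of the squeeze -/

section Semialgebraic

open Literature.NumberTheory.Transcendental.SemialgebraicMonotonicity

/-- The `v`-th barycentric coordinate as an affine map. [folklore] -/
noncomputable def baryAffine (v : F.τ) : (Fin n → ℝ) →ᵃ[ℝ] ℝ where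
  toFun x := F.bary x v
  linear := (LinearMap.proj v).comp (F.lam.comp (LinearMap.inl ℝ (Fin n → ℝ) ℝ))
  map_vadd' p w := by
    simp only [LinearMap.coe_comp, Function.comp_apply, LinearMap.inl_apply, LinearMap.coe_proj,
      Function.eval, vadd_eq_add, bary]
    have h : ((w + p, (1 : ℝ)) : (Fin n → ℝ) × ℝ) = (w, 0) + (p, 1) := by
      rw [Prod.mk_add_mk, zero_add]
    rw [h, map_add, Pi.add_apply]

/-- `baryAffine_apply`: elementary property of the squeeze frame / squeeze maps. [cite: CzaplaPawlucki2018, §2 Part II] -/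
theorem baryAffine_apply (v : F.τ) (x : Fin n → ℝ) : F.baryAffine v x = F.bary x v := rfl

/-- **The barycentric coordinates are semialgebraic functions.** [cite: BochnakCosteRoy1998, §2.2] -/
theorem isSemialgebraicFunOn_bary {s : Set (Fin n → ℝ)} (hs : IsSemialgebraic ℝ s) (v : F.τ) :
    IsSemialgebraicFunOn ℝ s fun x => F.bary x v :=
  AffineMap.isSemialgebraicFunOn (F.baryAffine v) hs

/-- `isSemialgebraicFunOn_proj_apply`: elementary property of the squeeze frame / squeeze maps. [cite: CzaplaPawlucki2018, §2 Part II] -/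
theorem isSemialgebraicFunOn_proj_apply {s : Set (Fin n → ℝ)} (hs : IsSemialgebraic ℝ s) (i : Fin n) :
    IsSemialgebraicFunOn ℝ s fun x => F.proj x i := by
  have h : (fun x => F.proj x i) = fun x => ∑ v, F.bary x v * (v : Fin n → ℝ) i := by
    funext x
    simp [proj, Finset.sum_apply]
  rw [h]
  exact IsSemialgebraicFunOn.finset_sum hs _ fun v _ =>
    IsSemialgebraicFunOn.mul_holds (F.isSemialgebraicFunOn_bary hs v)
      (isSemialgebraicFunOn_algebraMap hs ((v : Fin n → ℝ) i))

/-- `isSemialgebraicFunOn_perp_apply`: elementary property of the squeeze frame / squeeze maps. [cite: CzaplaPawlucki2018, §2 Part II] -/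
theorem isSemialgebraicFunOn_perp_apply {s : Set (Fin n → ℝ)} (hs : IsSemialgebraic ℝ s) (i : Fin n) :
    IsSemialgebraicFunOn ℝ s fun x => F.perp x i := by
  have h : (fun x => F.perp x i) = fun x => x i - F.proj x i := by
    funext x; simp [perp]
  rw [h]
  exact IsSemialgebraicFunOn.sub_holds (isSemialgebraicFunOn_apply hs i) (F.isSemialgebraicFunOn_proj_apply hs i)

/-- Finite products of real-semialgebraic functions. [cite: BochnakCosteRoy1998, Prop. 2.2.6] -/
theorem _root_.Literature.ModelTheory.ExponentialFields.IsSemialgebraicFunOn.finset_prod' {ι : Type*}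
    {s : Set (Fin n → ℝ)} (hs : IsSemialgebraic ℝ s) (I : Finset ι) {f : ι → (Fin n → ℝ) → ℝ}
    (hf : ∀ i ∈ I, IsSemialgebraicFunOn ℝ s (f i)) : IsSemialgebraicFunOn ℝ s (fun x => ∏ i ∈ I, f i x) := by
  classical
  induction I using Finset.induction_on with
  | empty => simpa using isSemialgebraicFunOn_algebraMap hs (1 : ℝ)
  | insert a I ha ih =>
    have h := IsSemialgebraicFunOn.mul_holds (hf a (Finset.mem_insert_self a I))
      (ih fun i hi => hf i (Finset.mem_insert_of_mem hi))
    convert h using 1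
    funext x
    rw [Finset.prod_insert ha]
    rfl

/-- `isSemialgebraicFunOn_omega`: elementary property of the squeeze frame / squeeze maps. [cite: CzaplaPawlucki2018, §2 Part II] -/
theorem isSemialgebraicFunOn_omega {s : Set (Fin n → ℝ)} (hs : IsSemialgebraic ℝ s) :
    IsSemialgebraicFunOn ℝ s F.omega :=
  IsSemialgebraicFunOn.finset_prod' hs _ fun v _ => F.isSemialgebraicFunOn_bary hs v

/-- Square roots of real-semialgebraic functions are real-semialgebraic (with `√` extended by
Mathlib's junk value). [cite: BochnakCosteRoy1998, §2.2] -/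
theorem _root_.Literature.ModelTheory.ExponentialFields.IsSemialgebraicFunOn.sqrt_comp
    {s : Set (Fin n → ℝ)} (hs : IsSemialgebraic ℝ s) {g : (Fin n → ℝ) → ℝ} (hg : IsSemialgebraicFunOn ℝ s g) :
    IsSemialgebraicFunOn ℝ s fun x => Real.sqrt (g x) := by
  have hmap : IsSemialgebraicMapOn ℝ s fun x => fun _ : Fin 1 => g x :=
    (Literature.NumberTheory.Transcendental.isSemialgebraicMapOn_iff_forall_holds hs).mpr fun _ => hg
  exact IsSemialgebraicFunOn.comp_isSemialgebraicMapOn_holds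
    (Literature.NumberTheory.Transcendental.isSemialgebraicFunOn_sqrt_univ (k := ℝ)) hmap (mapsTo_univ _ _)

/-- `isSemialgebraicFunOn_rad`: elementary property of the squeeze frame / squeeze maps. [cite: CzaplaPawlucki2018, §2 Part II] -/
theorem isSemialgebraicFunOn_rad {s : Set (Fin n → ℝ)} (hs : IsSemialgebraic ℝ s) :
    IsSemialgebraicFunOn ℝ s F.rad := by
  unfold rad
  refine IsSemialgebraicFunOn.sqrt_comp hs ?_
  refine IsSemialgebraicFunOn.finset_sum hs _ fun i _ => ?_
  have h : (fun x => F.perp x i ^ 2) = (fun x => F.perp x i) * fun x => F.perp x i := by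
    funext x; simp [sq]
  rw [h]
  exact IsSemialgebraicFunOn.mul_holds (F.isSemialgebraicFunOn_perp_apply hs i) (F.isSemialgebraicFunOn_perp_apply hs i)

/-- `isSemialgebraicFunOn_sparam`: elementary property of the squeeze frame / squeeze maps. [cite: CzaplaPawlucki2018, §2 Part II] -/
theorem isSemialgebraicFunOn_sparam {s : Set (Fin n → ℝ)} (hs : IsSemialgebraic ℝ s) (ε : ℝ) :
    IsSemialgebraicFunOn ℝ s (F.sparam ε) :=
  IsSemialgebraicFunOn.div₀ hs (F.isSemialgebraicFunOn_rad hs)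
    (IsSemialgebraicFunOn.mul_holds (isSemialgebraicFunOn_algebraMap hs ε) (F.isSemialgebraicFunOn_omega hs))

/-- **The squeeze `g` is a semialgebraic map.** [cite: CzaplaPawlucki2018, §2 Part II] -/
theorem isSemialgebraicMapOn_sqz {s : Set (Fin n → ℝ)} (hs : IsSemialgebraic ℝ s) (ε : ℝ) :
    IsSemialgebraicMapOn ℝ s (F.sqz ε) := by
  refine IsSemialgebraicMapOn.of_forall hs fun i => ?_
  have h : (fun x => F.sqz ε x i) = fun x => F.proj x i + smoothstep (F.sparam ε x) * F.perp x i := by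
    funext x; simp [sqz]
  rw [h]
  exact IsSemialgebraicFunOn.add_holds (F.isSemialgebraicFunOn_proj_apply hs i)
    (IsSemialgebraicFunOn.mul_holds (IsSemialgebraicFunOn.smoothstep_comp hs (F.isSemialgebraicFunOn_sparam hs ε))
      (F.isSemialgebraicFunOn_perp_apply hs i))

/-- The inverse squeeze is given by one formula everywhere (with `x / 0 = 0`). [folklore] -/
theorem unsqz_eq (ε : ℝ) (x : Fin n → ℝ) :
    F.unsqz ε x = F.proj x + (ε * F.omega x * psiInv (F.sparam ε x) / F.rad x) • F.perp x := by
  unfold unsqz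
  split_ifs with h
  · rw [h, div_zero, zero_smul, add_zero]
    have hp : F.perp x = 0 := (F.rad_eq_zero_iff x).mp h
    conv_lhs => rw [← F.proj_add_perp x, hp, add_zero]
  · rfl

/-- **The inverse squeeze `g⁻¹` is a semialgebraic map.** [cite: CzaplaPawlucki2018, §2 Part II] -/
theorem isSemialgebraicMapOn_unsqz {s : Set (Fin n → ℝ)} (hs : IsSemialgebraic ℝ s) (ε : ℝ) :
    IsSemialgebraicMapOn ℝ s (F.unsqz ε) := by
  refine IsSemialgebraicMapOn.of_forall hs fun i => ?_
  have h : (fun x => F.unsqz ε x i) =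
      fun x => F.proj x i + ε * F.omega x * psiInv (F.sparam ε x) / F.rad x * F.perp x i := by
    funext x
    rw [F.unsqz_eq]
    simp
  rw [h]
  refine IsSemialgebraicFunOn.add_holds (F.isSemialgebraicFunOn_proj_apply hs i)
    (IsSemialgebraicFunOn.mul_holds ?_ (F.isSemialgebraicFunOn_perp_apply hs i))
  refine IsSemialgebraicFunOn.div₀ hs ?_ (F.isSemialgebraicFunOn_rad hs)
  exact IsSemialgebraicFunOn.mul_holds
    (IsSemialgebraicFunOn.mul_holds (isSemialgebraicFunOn_algebraMap hs ε) (F.isSemialgebraicFunOn_omega hs))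
    (IsSemialgebraicFunOn.psiInv_comp hs (F.isSemialgebraicFunOn_sparam hs ε))

/-- The core is a semialgebraic set. [cite: BochnakCosteRoy1998, §2.2] -/
theorem isSemialgebraic_core : IsSemialgebraic ℝ F.core := by
  have h : F.core = ⋂ v ∈ (Finset.univ : Finset F.τ), {x | 0 < F.bary x v} := by
    ext x; simp [core]
  rw [h]
  refine IsSemialgebraic.biInter _ _ fun v _ => ?_
  exact AffineMap.isSemialgebraic_setOf_pos (F.baryAffine v)

/-- **The panel beating `h_ε` is a semialgebraic map of `ℝⁿ`.** [cite: CzaplaPawlucki2018, §2 Part II] -/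
theorem isSemialgebraicMapOn_squeeze (ε : ℝ) : IsSemialgebraicMapOn ℝ univ (F.squeeze ε) := by
  classical
  refine IsSemialgebraicMapOn.of_forall isSemialgebraic_univ fun i => ?_
  refine IsSemialgebraicFunOn.of_finset_cover (I := ({true, false} : Finset Bool))
    (B := fun b => if b then F.core else F.coreᶜ) ?_ fun b _ => ?_
  · ext x
    by_cases hx : x ∈ F.core <;> simp [hx]
  · cases b
    · simp only [Bool.false_eq_true, ↓reduceIte]
      exact (isSemialgebraicFunOn_apply F.isSemialgebraic_core.compl i).congr fun x hx => by
        show x i = F.squeeze ε x i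
        rw [F.squeeze_of_not_mem hx]
    · simp only [↓reduceIte]
      exact ((Literature.NumberTheory.Transcendental.isSemialgebraicMapOn_iff_forall_holds
        F.isSemialgebraic_core).mp (F.isSemialgebraicMapOn_sqz F.isSemialgebraic_core ε) i).congr
        fun x hx => by
          show F.sqz ε x i = F.squeeze ε x i
          rw [F.squeeze_of_mem hx]

/-- **The inverse panel beating `h_ε⁻¹` is a semialgebraic map of `ℝⁿ`.** [cite: CzaplaPawlucki2018, §2 Part II] -/
theorem isSemialgebraicMapOn_unsqueeze (ε : ℝ) : IsSemialgebraicMapOn ℝ univ (F.unsqueeze ε) := by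
  classical
  refine IsSemialgebraicMapOn.of_forall isSemialgebraic_univ fun i => ?_
  refine IsSemialgebraicFunOn.of_finset_cover (I := ({true, false} : Finset Bool))
    (B := fun b => if b then F.core else F.coreᶜ) ?_ fun b _ => ?_
  · ext x
    by_cases hx : x ∈ F.core <;> simp [hx]
  · cases b
    · simp only [Bool.false_eq_true, ↓reduceIte]
      exact (isSemialgebraicFunOn_apply F.isSemialgebraic_core.compl i).congr fun x hx => by
        show x i = F.unsqueeze ε x i
        rw [F.unsqueeze_of_not_mem hx]
    · simp only [↓reduceIte]
      exact ((Literature.NumberTheory.Transcendental.isSemialgebraicMapOn_iff_forall_holds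
        F.isSemialgebraic_core).mp (F.isSemialgebraicMapOn_unsqz F.isSemialgebraic_core ε) i).congr
        fun x hx => by
          show F.unsqz ε x i = F.unsqueeze ε x i
          rw [F.unsqueeze_of_mem hx]

/-- **The panel beating of one simplex is a semialgebraic homeomorphism of `ℝⁿ`.**
[cite: CzaplaPawlucki2018, §2 Part II] -/
theorem isSemialgHomeomorphOn_squeeze {ε : ℝ} (hε : 0 < ε) :
    IsSemialgHomeomorphOn ℝ (univ : Set (Fin n → ℝ)) univ (F.squeeze ε) (F.unsqueeze ε) :=
  ⟨fun _ _ => mem_univ _, fun _ _ => mem_univ _, fun x _ => F.unsqueeze_squeeze hε x,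
    fun y _ => F.squeeze_unsqueeze hε y, (F.continuous_squeeze hε).continuousOn,
    (F.continuous_unsqueeze hε).continuousOn, F.isSemialgebraicMapOn_squeeze ε⟩

end Semialgebraic

end SqueezeFrame

end SimplexFrame

end Literature.ModelTheory.ExponentialFields
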